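import Mathlib
import Literature.NumberTheory.Automorphic.EisensteinOrthogonality
import Literature.NumberTheory.Automorphic.ModularPretrace

/-!
# Theorem 7.4 for `SL₂(ℤ)` from the Parseval identity of `L²(SL₂(ℤ)\ℍ)` (Theorems 4.7 & 7.3)
(Iwaniec, *Spectral Methods of Automorphic Forms*, GSM 53, Thm 7.3 (7.15), §7.4 & Thm 7.4 (7.17),
Prop. 7.2 (7.10) and its proof (7.8)–(7.9), (12.5); PDF pp. 71–76, 125–126)

Top-down layer of the `provefact` decomposition of
`Literature.NumberTheory.Automorphic.Iwaniec2002_eq_12_5_modular` (`ModularLatticeCount.lean`; the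
pretrace estimate (12.5) for the modular group, the only named input of Selberg's lattice point
theorem `sl2BallCount_asymp` after `ModularLatticeCount.lean`). `ModularPretrace.lean` reduced (12.5)
to `Iwaniec2002_thm_7_4_modular` (Theorem 7.4 with Proposition 7.2 for `SL₂(ℤ)`, in datum form), and
the bottom-up layers 10–25 (`InvariantLaplacian.lean` … `ModularEisensteinFourier.lean`) have since
proved the whole *discrete* half of the spectral theorem for `L²(SL₂(ℤ)\ℍ)` — a Hilbert basis of Maass
cusp forms of the cuspidal subspace `𝓒` (Theorem 4.7, `MaassCuspForms.lean`), reality of their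
spectral parameters (Theorem 11.4, `RoelckeSelbergBound.lean`), the discrete half of (7.10)
(`LocalWeylLaw.lean`) — together with the continued Eisenstein series `E(z, 1/2 + ir)`
(`ModularEisensteinCriticalLine.lean`, `EisensteinOrthogonality.lean`). This file proves that what then
remains of Theorem 7.4 is *exactly* the Parseval identity of Theorem 7.3 (with Theorem 4.7), and
nothing about automorphic kernels, local Weyl laws or pointwise convergence:

1. `IsFdTest` (test functions on `𝒟`: measurable, bounded, vanishing high in the cusp),
   `eisenCoeff f r = ⟨E(·, 1/2 + ir), f⟩`, and the predicate `HasModularParseval f`: the Eisenstein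
   coefficients of `f` are in `L²(ℝ)` and
   `‖f‖² = (3/π)|∫_𝒟 f|² + ‖P_𝓒 f‖² + (1/4π) ∫_ℝ |⟨E(·, 1/2+ir), f⟩|² dr`
   — Theorems 4.7 and 7.3 for `Γ = SL₂(ℤ)` in Parseval form ((7.15) paired with `f`; one cusp, the
   residual spectrum being the constant `u₀ = √(3/π)`, (3.26)) say `HasModularParseval f` for every
   test function `f`. This assertion is the HYPOTHESIS `h73` of everything below (it is not asserted
   or named as a closed fact in this file); the results are implications
   `(∀ f, IsFdTest f → HasModularParseval f) → …`.
2. PROVED, the sesquilinear form of 1 by polarization (`parseval_polar`).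
3. PROVED: automorphic kernels `K(·, z)` of test kernels are test functions on `𝒟` (they vanish for
   `Im w` large: every `γ w` has height `Im w` or `≤ 1/Im w`), and their spectral coefficients by
   unfolding and Theorem 1.16: mass `2h(i/2)`, `⟨u_j, K(·, z)⟩ = 2h(t_j) ū_j(z)`,
   `⟨E(·, 1/2+ir), K(·, z)⟩ = 2h(r) Ē(z, 1/2+ir)` (`h(t) ∈ ℝ` for real `t`).
4. PROVED, **the Eisenstein half of (7.10) from Parseval** (`eisenstein_localWeyl_of_parseval`):
   `∫_{-T}^{T} |E(z, 1/2 + it)|² dt ≤ 8192 N(z) T²`, by Bessel's inequality for `K(·, z)` with the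
   kernel `𝟙_{[0,δ]}`, `δ = (64T)⁻²`, exactly as in the printed proof of Proposition 7.2 (the discrete
   half being `LocalWeylLaw.sum_norm_sq_eigenfunctions_le`).
5. PROVED, an approximate identity of point-pair invariants `k_n` (`bump`: smooth, mass
   `4π∫k_n = 1`, support `→ {0}`): `|h_n(t)| ≤ 1`, `h_n(t) → 1` (`t ∈ ℝ`), `L_{k_n}U(z) → U(z)` for
   continuous `U`.
6. PROVED, **Theorem 7.4 (7.17) for `SL₂(ℤ)` from 1** (`automorphicKernel_eq_spectralExpansion`): for a
   continuous compactly supported `k` with admissible transform ((1.63)), every Hilbert basis `(u_i)`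
   of Maass cusp forms of `𝓒` and all `z, w`:
   `Σ_{γ ∈ SL₂(ℤ)} k(u(γz, w)) = 2[(3/π)h(i/2) + Σ_i h(t_i)u_i(z)ū_i(w) + (1/4π)∫ h(r)E(z,1/2+ir)Ē(w,1/2+ir) dr]`
   with absolute convergence. Proof: the polarized Parseval identity for the pair `K_{k_n}(·, z)`,
   `K_k(·, w)` reads `2 L_{k_n}(K_k(·, w))(z) = 4[(3/π)h_n(i/2)h(i/2) + Σ_i h_n(t_i)h(t_i)u_iū_i
   + (1/4π)∫ h_n h E Ē]` (`parseval_kernels`, (7.17) for the composed kernel); let `n → ∞`, by 5 on the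
   left and by dominated convergence on the right, the majorants coming from (7.10) at `z` and `w`,
   Cauchy's inequality and the partial summation of `ModularPretrace.lean`. (The book, p. 76, argues
   through the pointwise form of (7.15) on `𝓓(Γ\ℍ)` and "a suitable approximation".)
7. PROVED: the `ModularSpectralDatum` of `SL₂(ℤ)` (enumerating the Hilbert basis through `ℕ` with
   zero padding) and **`Iwaniec2002_thm_7_4_modular_of_parseval`**, hence
   **`Iwaniec2002_eq_12_5_modular_of_parseval`**, `sl2BallCount_asymp_of_parseval` and (12.12), all
   under the hypothesis `∀ f, IsFdTest f → HasModularParseval f`.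

State of the decomposition after this layer:
`sl2BallCount_asymp ⇐ Iwaniec2002_eq_12_5_modular ⇐ Iwaniec2002_thm_7_4_modular ⇐ (∀ f, IsFdTest f → HasModularParseval f)`,
the last being the completeness of `ℂ ⊕ 𝓒 ⊕ 𝓔` in `L²(SL₂(ℤ)\ℍ)` with the Plancherel measure
`dr/4π` for the Eisenstein transform (Proposition 7.1 and §7.3 of the book: Maass–Selberg,
incomplete Eisenstein series, (7.12)–(7.14)) — the continuous half of the spectral theorem, and now the
only unproved input of Corollary 12.2 for the modular group.

Held copy: `book:iwaniec2002-spectral-methods-automorphic-forms` (pp. 69–77, 125–126 read).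
Mathlib: `HilbertBasis.hasSum_inner_mul_inner`, `Submodule.orthogonalProjectionOnto`,
`Submodule.inner_orthogonalProjectionOnto_eq_of_mem_right/left`, `inner_eq_sum_norm_sq_div_four`,
`MeasureTheory.L2.inner_def`, `MemLp.toLp_add/sub/const_smul/congr`, `tendsto_tsum_of_dominated_convergence`,
`tendsto_integral_of_dominated_convergence`, `Encodable.decode₂`, `Finset.sum_preimage`,
`Function.Injective.tsum_eq/summable_iff`, `ModularGroup.im_smul_eq_div_normSq`,
`integrableOn_add_rpow_Ioi_of_lt`. Literature: `exists_hilbertBasis_maassCuspForms`, `IsMaassCuspForm`,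
`cuspFamily` (`MaassCuspForms.lean`); `IsMaassCuspForm.eigenvalue_ge` (`RoelckeSelbergBound.lean`);
`eisensteinCrit`, `invariantOperator_eisensteinCrit`, `continuous_eisensteinCrit`,
`isC2_and_eigen_eisensteinCrit` (`ModularEisensteinCriticalLine.lean`); `cuspSubmodule`,
`completeSpace_cuspSubmodule`, `isCompact_fdTrunc`, `isFiniteMeasure_restrict_fd`
(`CuspidalSubspace.lean`, `CuspFormsCompact.lean`); `sum_norm_sq_eigenfunctions_le`,
`memLp_automorphicKernel_ballKernel`, `norm_selbergTransform_ballKernel_ge`, `ballKernel`, `orbitCount`,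
`Bessel.integral_norm_sq_eq` (`LocalWeylLaw.lean`); `setIntegral_automorphicKernel_mul(_conj)`,
`tsum_kernel_eq_automorphicKernel`, `automorphicKernel_comm/_smul_left` (`FundamentalDomainUnfolding.lean`);
`continuous_automorphicKernel_left` (`AutomorphicKernelOperators.lean`); `cutKernel`, `cutMass_pos`,
`cutKernel_pointPairInv_eq_zero` (`ModularPartitionOfUnity.lean`); `stKernel` & co. (`MaassCuspForms.lean`);
`invariantOperator`, `integral_kernel_eq`, `invariantOperator_const`, `integrable_kernel_mul_of_continuous`
(`InvariantIntegralOperators.lean`); `selbergTransform_I_half`, `selbergTransform_neg`,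
`integral_exp/cosh_mul_selbergG`, `integral_selbergQ_mul_rpow`, `selbergG_eq_zero`, `IsAdmissibleTransform`
(`SelbergTransform.lean`); `Pretrace.tsum_spectral_le`, `Pretrace.integral_spectral_le`,
`ModularSpectralDatum`, `Iwaniec2002_eq_12_5_modular_of_thm_7_4`, `sl2BallCount_asymp_of_thm_7_4`
(`ModularPretrace.lean`). Neither Mathlib nor Literature had the Parseval/Plancherel identity for
`L²(SL₂(ℤ)\ℍ)`, the Eisenstein half of (7.10), or the expansion (7.17)
(`lean search 'Parseval.*modular|eisenCoeff|spectralExpansion|localWeyl.*[Ee]isenstein|HasModularParseval'`).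

## References
* [Iwaniec2002] H. Iwaniec, *Spectral Methods of Automorphic Forms*, 2nd ed., GSM 53, AMS 2002,
  Thm 7.3 (7.15), PDF p. 75; §7.4 & Thm 7.4 (7.17), PDF p. 76; Prop. 7.2 (7.10) and its proof
  (7.8)–(7.9), PDF pp. 71–73; Thm 4.7 (4.15), PDF p. 52; (3.26), PDF p. 47; (1.63), PDF p. 24;
  (12.5) & Cor. 12.2, PDF pp. 125–126.
-/

noncomputable section

open MeasureTheory Set Filter Real UpperHalfPlane
open scoped Topology MatrixGroups ComplexConjugate NNReal ENNReal Modular InnerProductSpace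

namespace Literature.NumberTheory.Automorphic

local notation "Γℤ" => (𝒮ℒ : Subgroup (GL (Fin 2) ℝ))
set_option quotPrecheck false in
/-- The measure of `L²(𝒟)`: the hyperbolic measure restricted to `𝒟`. -/
local notation "μ𝒟" => MeasureTheory.Measure.restrict (volume : Measure ℍ) (ModularGroup.fd)

/-! ## 1. Test functions on the fundamental domain -/

/-- **Test functions on `𝒟`**: a.e.-strongly measurable and bounded on `𝒟`, and vanishing on `𝒟`
above some height `Y` (i.e. supported in the compact truncated domain `𝒟_Y`, (2.3)). Automorphic
kernels `K(·, w)` of compactly supported point-pair invariants are of this kind, and so are the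
incomplete Eisenstein series; the class is dense in `L²(𝒟)`. [cite: Iwaniec2002, (2.3) & §7.2, PDF pp. 30, 72] -/
structure IsFdTest (f : ℍ → ℂ) : Prop where
  aestronglyMeasurable : AEStronglyMeasurable f μ𝒟
  bounded : ∃ B, ∀ z ∈ 𝒟, ‖f z‖ ≤ B
  cusp : ∃ Y, ∀ z ∈ 𝒟, Y ≤ z.im → f z = 0

namespace IsFdTest

variable {f g : ℍ → ℂ}

/-- Sums of test functions are test functions. [folklore] -/
theorem add (hf : IsFdTest f) (hg : IsFdTest g) : IsFdTest (f + g) := by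
  obtain ⟨B, hB⟩ := hf.bounded
  obtain ⟨C, hC⟩ := hg.bounded
  obtain ⟨Y, hY⟩ := hf.cusp
  obtain ⟨Y', hY'⟩ := hg.cusp
  refine ⟨hf.aestronglyMeasurable.add hg.aestronglyMeasurable, ⟨B + C, fun z hz => ?_⟩,
    ⟨max Y Y', fun z hz h => ?_⟩⟩
  · exact (norm_add_le _ _).trans (add_le_add (hB z hz) (hC z hz))
  · simp [hY z hz ((le_max_left _ _).trans h), hY' z hz ((le_max_right _ _).trans h)]

/-- Scalar multiples of test functions are test functions. [folklore] -/
theorem const_smul (hf : IsFdTest f) (c : ℂ) : IsFdTest (c • f) := by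
  obtain ⟨B, hB⟩ := hf.bounded
  obtain ⟨Y, hY⟩ := hf.cusp
  refine ⟨hf.aestronglyMeasurable.const_smul c, ⟨‖c‖ * B, fun z hz => ?_⟩, ⟨Y, fun z hz h => ?_⟩⟩
  · rw [Pi.smul_apply, norm_smul]
    exact mul_le_mul_of_nonneg_left (hB z hz) (norm_nonneg _)
  · simp [hY z hz h]

/-- Differences of test functions are test functions. [folklore] -/
theorem sub (hf : IsFdTest f) (hg : IsFdTest g) : IsFdTest (f - g) := by
  have h := hf.add (hg.const_smul (-1))
  have e : f + (-1 : ℂ) • g = f - g := by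
    funext z; simp [sub_eq_add_neg]
  rwa [e] at h

/-- The product of a test function with a continuous function is a test function. [folklore] -/
theorem continuous_mul (hf : IsFdTest f) {φ : ℍ → ℂ} (hφ : Continuous φ) :
    IsFdTest (fun z => φ z * f z) := by
  obtain ⟨B, hB⟩ := hf.bounded
  obtain ⟨Y, hY⟩ := hf.cusp
  -- `φ` is bounded on the compact truncated domain `𝒟_Y`
  obtain ⟨C, hC⟩ := (isCompact_fdTrunc Y).exists_bound_of_continuousOn hφ.continuousOn
  have hB0 : 0 ≤ B := by
    obtain ⟨z, hz⟩ : ∃ z : ℍ, z ∈ 𝒟 := ⟨UpperHalfPlane.I, by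
      refine ⟨by simp [UpperHalfPlane.I], by simp [UpperHalfPlane.I]⟩⟩
    exact (norm_nonneg _).trans (hB z hz)
  refine ⟨(hφ.aestronglyMeasurable.restrict).mul hf.aestronglyMeasurable,
    ⟨max C 0 * B, fun z hz => ?_⟩, ⟨Y, fun z hz h => by simp [hY z hz h]⟩⟩
  rw [norm_mul]
  by_cases hzY : z.im ≤ Y
  · exact mul_le_mul ((hC z ⟨hz, hzY⟩).trans (le_max_left _ _)) (hB z hz) (norm_nonneg _)
      (le_max_right _ _)
  · rw [hY z hz (le_of_lt (not_le.mp hzY)), norm_zero, mul_zero]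
    exact mul_nonneg (le_max_right _ _) hB0

/-- Test functions are in `L²(𝒟)`. [folklore] -/
theorem memLp_two (hf : IsFdTest f) : MemLp f 2 μ𝒟 := by
  haveI : IsFiniteMeasure μ𝒟 := isFiniteMeasure_restrict_fd
  obtain ⟨B, hB⟩ := hf.bounded
  refine MemLp.of_bound hf.aestronglyMeasurable B ?_
  filter_upwards [ae_restrict_mem isHypFundamentalDomain_modular_fd.measurableSet] with z hz
  exact hB z hz

/-- Test functions are integrable on `𝒟`. [folklore] -/
theorem integrable (hf : IsFdTest f) : Integrable f μ𝒟 := by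
  haveI : IsFiniteMeasure μ𝒟 := isFiniteMeasure_restrict_fd
  exact hf.memLp_two.integrable (by norm_num)

end IsFdTest

/-! ## 2. The Eisenstein coefficients `⟨E(·, 1/2 + ir), f⟩` and the Parseval identity (Theorems 4.7 & 7.3) -/

/-- **The Eisenstein coefficient** of a test function: `c_f(r) = ∫_𝒟 Ē(z, 1/2 + ir) f(z) dμ(z)`
(`= ⟨E(·, 1/2+ir), f⟩` in Mathlib's convention for the `L²` inner product, conjugate-linear in
the first slot; the book's `⟨f, E(·, 1/2 + ir)⟩` of (7.15) is its complex conjugate).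
[cite: Iwaniec2002, Thm 7.3 (7.15), PDF p. 75] -/
def eisenCoeff (f : ℍ → ℂ) (r : ℝ) : ℂ :=
  ∫ z in ModularGroup.fd, conj (eisensteinCrit z r) * f z

/-- Continuity of `z ↦ Ē(z, 1/2 + ir)`. [folklore] -/
theorem continuous_conj_eisensteinCrit (r : ℝ) : Continuous fun z : ℍ => conj (eisensteinCrit z r) :=
  Complex.continuous_conj.comp (isC2_and_eigen_eisensteinCrit r).1.continuous

/-- Additivity of the Eisenstein coefficients. [folklore] -/
theorem eisenCoeff_add {f g : ℍ → ℂ} (hf : IsFdTest f) (hg : IsFdTest g) (r : ℝ) :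
    eisenCoeff (f + g) r = eisenCoeff f r + eisenCoeff g r := by
  unfold eisenCoeff
  rw [← integral_add (hf.continuous_mul (continuous_conj_eisensteinCrit r)).integrable
    (hg.continuous_mul (continuous_conj_eisensteinCrit r)).integrable]
  congr 1 with z
  simp only [Pi.add_apply]
  ring

/-- Homogeneity of the Eisenstein coefficients. [folklore] -/
theorem eisenCoeff_smul (c : ℂ) (f : ℍ → ℂ) (r : ℝ) :
    eisenCoeff (c • f) r = c * eisenCoeff f r := by
  unfold eisenCoeff
  rw [← integral_const_mul]
  congr 1 with z
  simp only [Pi.smul_apply, smul_eq_mul]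
  ring

/-- As functions of `r`: `c_{f+g} = c_f + c_g`. [folklore] -/
theorem eisenCoeff_add_fun {f g : ℍ → ℂ} (hf : IsFdTest f) (hg : IsFdTest g) :
    eisenCoeff (f + g) = eisenCoeff f + eisenCoeff g :=
  funext fun r => eisenCoeff_add hf hg r

/-- As functions of `r`: `c_{c f} = c · c_f`. [folklore] -/
theorem eisenCoeff_smul_fun (c : ℂ) (f : ℍ → ℂ) : eisenCoeff (c • f) = c • eisenCoeff f :=
  funext fun r => by rw [Pi.smul_apply, smul_eq_mul, eisenCoeff_smul]

/-- **The Parseval identity of `L²(SL₂(ℤ)\ℍ)` for the function `f`** (Iwaniec, Theorems 4.7 and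
7.3 for the modular group, read as a property of `f`). The spectral decomposition
`L²(Γ\ℍ) = ℂ ⊕ 𝓒 ⊕ 𝓔` for `Γ = SL₂(ℤ)` consists of the constants (the residue
`u₀ = |F|^{-1/2} = √(3/π)` of `E(z, s)` at its only pole `s = 1` in `Re s ≥ 1/2`, (3.26), (6.33)),
the cuspidal subspace `𝓒` spanned by Maass cusp forms (Theorem 4.7, proved in `MaassCuspForms.lean`;
here it enters only through the orthogonal projection onto the closed subspace `cuspSubmodule`), and
the space `𝓔` of the Eisenstein series `E(z, 1/2 + ir)` on which `Δ` has absolutely continuous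
spectrum of multiplicity one with the Plancherel measure `dr/4π` (Theorem 7.3, (7.15)). Pairing the
norm-convergent expansion (7.15)+(4.15) of `f` with `f` ("Combining Theorems 4.7 and 7.3 one gets the
spectral decomposition of the whole space `L²(Γ\ℍ)`", p. 75) gives, for a test function `f` on `𝒟`:
the Eisenstein coefficients `r ↦ ⟨E(·, 1/2 + ir), f⟩` are square-integrable and
`‖f‖² = (3/π) |∫_𝒟 f dμ|² + ‖P_𝓒 f‖² + (1/4π) ∫_{-∞}^{∞} |⟨E(·, 1/2 + ir), f⟩|² dr`.
This structure records that identity for `f` (Eisenstein series in the normalisation `eisensteinCrit`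
of `ModularEisensteinCriticalLine.lean`, `E(z, 1/2 + ir) = E*(z, s)/θ(s)`). Theorems 4.7 & 7.3 for
`SL₂(ℤ)` assert `HasModularParseval f` for every `f` with `IsFdTest f`; that assertion — the
continuous half of the spectral theorem — is the HYPOTHESIS of the reductions below and is not proved
in the tree yet (nor asserted here).
[cite: Iwaniec2002, Thm 7.3 (7.15) & Thm 4.7 (4.15), PDF pp. 52, 75; (3.26), PDF p. 47] -/
structure HasModularParseval (f : ℍ → ℂ) : Prop where
  memLp_eisenCoeff : MemLp (eisenCoeff f) 2 (volume : Measure ℝ)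
  norm_sq_eq : ∀ hf2 : MemLp f 2 μ𝒟,
    ∫ z in ModularGroup.fd, ‖f z‖ ^ 2 =
      3 / π * ‖∫ z in ModularGroup.fd, f z‖ ^ 2 +
        ‖cuspSubmodule.orthogonalProjectionOnto (hf2.toLp f)‖ ^ 2 +
        1 / (4 * π) * ∫ r : ℝ, ‖eisenCoeff f r‖ ^ 2

/-! ## 3. Polarization: the Parseval identity in sesquilinear form -/

section L2Generic

variable {X : Type*} [MeasurableSpace X] {μ : Measure X} {f g : X → ℂ}

/-- `⟨[f], [g]⟩ = ∫ f̄ g` for classes of `L²` functions. [folklore] -/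
theorem inner_toLp_toLp_eq_integral (hf : MemLp f 2 μ) (hg : MemLp g 2 μ) :
    ⟪hf.toLp f, hg.toLp g⟫_ℂ = ∫ x, conj (f x) * g x ∂μ := by
  rw [L2.inner_def]
  refine integral_congr_ae ?_
  filter_upwards [hf.coeFn_toLp, hg.coeFn_toLp] with x hfx hgx
  rw [hfx, hgx, mul_comm]
  simp

/-- `‖[f]‖² = ∫ |f|²` for the class of an `L²` function. [folklore] -/
theorem norm_toLp_sq_eq_integral (hf : MemLp f 2 μ) : ‖hf.toLp f‖ ^ 2 = ∫ x, ‖f x‖ ^ 2 ∂μ := by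
  have h := inner_toLp_toLp_eq_integral hf hf
  have e : (∫ x, conj (f x) * f x ∂μ) = ((∫ x, ‖f x‖ ^ 2 ∂μ : ℝ) : ℂ) := by
    rw [Bessel.integral_norm_sq_eq]
    congr 1 with x; ring
  rw [e] at h
  have h3 : ‖hf.toLp f‖ ^ 2 = RCLike.re ⟪hf.toLp f, hf.toLp f⟫_ℂ := (inner_self_eq_norm_sq _).symm
  rw [h3, RCLike.re_to_complex, h, Complex.ofReal_re]

/-- `‖[f]‖²` as a complex number. [folklore] -/
theorem norm_toLp_sq_eq_integral_complex (hf : MemLp f 2 μ) :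
    ((‖hf.toLp f‖ : ℂ)) ^ 2 = ((∫ x, ‖f x‖ ^ 2 ∂μ : ℝ) : ℂ) := by
  rw [← Complex.ofReal_pow, norm_toLp_sq_eq_integral]

end L2Generic

section Polarization

variable {f g : ℍ → ℂ}

/-- The orthogonal projection onto the (closed, complete) cuspidal subspace `𝓒 ⊆ L²(𝒟)`. -/
local notation "P𝓒" => (cuspSubmodule.orthogonalProjectionOnto :
  Lp ℂ 2 (MeasureTheory.Measure.restrict (volume : Measure ℍ) ModularGroup.fd) →L[ℂ] cuspSubmodule)

/-- The polarization identity in `ℂ`: `ā b = (|a+b|² - |a-b|² + (|a - ib|² - |a + ib|²) i)/4`. [folklore] -/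
theorem conj_mul_eq_polar (a b : ℂ) :
    conj a * b = (((‖a + b‖ : ℂ)) ^ 2 - ((‖a - b‖ : ℂ)) ^ 2 +
      (((‖a - Complex.I * b‖ : ℂ)) ^ 2 - ((‖a + Complex.I * b‖ : ℂ)) ^ 2) * Complex.I) / 4 := by
  have h := inner_eq_sum_norm_sq_div_four (𝕜 := ℂ) a b
  simp only [RCLike.I_to_complex, smul_eq_mul] at h
  have h2 : ⟪a, b⟫_ℂ = conj a * b := by
    rw [mul_comm]; simp
  exact h2.symm.trans h

/-- **The Parseval identity in sesquilinear form** (polarization of `HasModularParseval`):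
for test functions `f, g` on `𝒟`,
`∫_𝒟 f̄ g dμ = (3/π) conj(∫_𝒟 f)(∫_𝒟 g) + ⟨P_𝓒 f, P_𝓒 g⟩ + (1/4π) ∫_{-∞}^{∞} c̄_f(r) c_g(r) dr` —
(7.15) paired with `g`. [cite: Iwaniec2002, Thm 7.3 (7.15), PDF p. 75] -/
theorem parseval_polar (h73 : ∀ f : ℍ → ℂ, IsFdTest f → HasModularParseval f) (hf : IsFdTest f) (hg : IsFdTest g) :
    (∫ z in ModularGroup.fd, conj (f z) * g z) =
      3 / π * (conj (∫ z in ModularGroup.fd, f z) * ∫ z in ModularGroup.fd, g z) +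
      ⟪P𝓒 (hf.memLp_two.toLp f), P𝓒 (hg.memLp_two.toLp g)⟫_ℂ +
      1 / (4 * π) * ∫ r : ℝ, conj (eisenCoeff f r) * eisenCoeff g r := by
  -- the four polar combinations
  have hI : IsFdTest (Complex.I • g) := hg.const_smul Complex.I
  have h1 : IsFdTest (f + g) := hf.add hg
  have h2 : IsFdTest (f - g) := hf.sub hg
  have h3 : IsFdTest (f - Complex.I • g) := hf.sub hI
  have h4 : IsFdTest (f + Complex.I • g) := hf.add hI
  have hf2 := hf.memLp_two
  have hg2 := hg.memLp_two
  have hI2 : MemLp (Complex.I • g) 2 μ𝒟 := hg2.const_smul Complex.I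
  set F := hf2.toLp f with hF
  set G := hg2.toLp g with hG
  -- Parseval for the four combinations
  obtain ⟨hc1, E1⟩ := (⟨(h73 _ h1).memLp_eisenCoeff, (h73 _ h1).norm_sq_eq (hf2.add hg2)⟩ : _ ∧ _)
  obtain ⟨hc2, E2⟩ := (⟨(h73 _ h2).memLp_eisenCoeff, (h73 _ h2).norm_sq_eq (hf2.sub hg2)⟩ : _ ∧ _)
  obtain ⟨hc3, E3⟩ := (⟨(h73 _ h3).memLp_eisenCoeff, (h73 _ h3).norm_sq_eq (hf2.sub hI2)⟩ : _ ∧ _)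
  obtain ⟨hc4, E4⟩ := (⟨(h73 _ h4).memLp_eisenCoeff, (h73 _ h4).norm_sq_eq (hf2.add hI2)⟩ : _ ∧ _)
  have hcf := (h73 f hf).memLp_eisenCoeff
  have hcg := (h73 g hg).memLp_eisenCoeff
  -- the classes of the combinations
  have hIG : hI2.toLp (Complex.I • g) = Complex.I • G := MemLp.toLp_const_smul _ _
  have c1 : (hf2.add hg2).toLp (f + g) = F + G := MemLp.toLp_add hf2 hg2
  have c2 : (hf2.sub hg2).toLp (f - g) = F - G := MemLp.toLp_sub hf2 hg2
  have c3 : (hf2.sub hI2).toLp (f - Complex.I • g) = F - Complex.I • G := by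
    rw [MemLp.toLp_sub hf2 hI2, hIG]
  have c4 : (hf2.add hI2).toLp (f + Complex.I • g) = F + Complex.I • G := by
    rw [MemLp.toLp_add hf2 hI2, hIG]
  -- the Eisenstein coefficient classes
  set Cf := hcf.toLp (eisenCoeff f) with hCf
  set Cg := hcg.toLp (eisenCoeff g) with hCg
  have hcI : MemLp (eisenCoeff (Complex.I • g)) 2 (volume : Measure ℝ) := by
    rw [eisenCoeff_smul_fun]; exact hcg.const_smul _
  have hCI : hcI.toLp (eisenCoeff (Complex.I • g)) = Complex.I • Cg := by
    rw [hCg, ← MemLp.toLp_const_smul]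
    exact MemLp.toLp_congr _ _ (Eventually.of_forall fun r => by rw [eisenCoeff_smul_fun])
  have d1 : hc1.toLp (eisenCoeff (f + g)) = Cf + Cg := by
    rw [hCf, hCg, ← MemLp.toLp_add]
    exact MemLp.toLp_congr _ _ (Eventually.of_forall fun r => by rw [eisenCoeff_add_fun hf hg])
  have d2 : hc2.toLp (eisenCoeff (f - g)) = Cf - Cg := by
    rw [hCf, hCg, ← MemLp.toLp_sub]
    refine MemLp.toLp_congr _ _ (Eventually.of_forall fun r => ?_)
    have e : f - g = f + (-1 : ℂ) • g := by funext z; simp [sub_eq_add_neg]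
    rw [e, eisenCoeff_add_fun hf (hg.const_smul _), eisenCoeff_smul_fun]
    simp [sub_eq_add_neg]
  have d3 : hc3.toLp (eisenCoeff (f - Complex.I • g)) = Cf - Complex.I • Cg := by
    rw [← hCI, hCf, ← MemLp.toLp_sub]
    refine MemLp.toLp_congr _ _ (Eventually.of_forall fun r => ?_)
    have e : f - Complex.I • g = f + (-1 : ℂ) • (Complex.I • g) := by funext z; simp [sub_eq_add_neg]
    rw [e, eisenCoeff_add_fun hf (hI.const_smul _), eisenCoeff_smul_fun]
    simp [sub_eq_add_neg]
  have d4 : hc4.toLp (eisenCoeff (f + Complex.I • g)) = Cf + Complex.I • Cg := by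
    rw [← hCI, hCf, ← MemLp.toLp_add]
    exact MemLp.toLp_congr _ _ (Eventually.of_forall fun r => by rw [eisenCoeff_add_fun hf hI])
  -- integrals of the combinations
  have i1 : ∫ z in ModularGroup.fd, (f + g) z = (∫ z in ModularGroup.fd, f z) + ∫ z in ModularGroup.fd, g z :=
    integral_add hf.integrable hg.integrable
  have i2 : ∫ z in ModularGroup.fd, (f - g) z = (∫ z in ModularGroup.fd, f z) - ∫ z in ModularGroup.fd, g z :=
    integral_sub hf.integrable hg.integrable
  have iI : ∫ z in ModularGroup.fd, (Complex.I • g) z = Complex.I * ∫ z in ModularGroup.fd, g z := by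
    simp only [Pi.smul_apply, smul_eq_mul]; exact integral_const_mul _ _
  have i3 : ∫ z in ModularGroup.fd, (f - Complex.I • g) z =
      (∫ z in ModularGroup.fd, f z) - Complex.I * ∫ z in ModularGroup.fd, g z := by
    rw [← iI]; exact integral_sub hf.integrable hI.integrable
  have i4 : ∫ z in ModularGroup.fd, (f + Complex.I • g) z =
      (∫ z in ModularGroup.fd, f z) + Complex.I * ∫ z in ModularGroup.fd, g z := by
    rw [← iI]; exact integral_add hf.integrable hI.integrable
  -- the four polarizations
  have pol1 : (∫ z in ModularGroup.fd, conj (f z) * g z) =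
      (((‖F + G‖ : ℂ)) ^ 2 - ((‖F - G‖ : ℂ)) ^ 2 +
        (((‖F - Complex.I • G‖ : ℂ)) ^ 2 - ((‖F + Complex.I • G‖ : ℂ)) ^ 2) * Complex.I) / 4 := by
    rw [← inner_toLp_toLp_eq_integral hf2 hg2]
    have h := inner_eq_sum_norm_sq_div_four (𝕜 := ℂ) F G
    simp only [RCLike.I_to_complex] at h
    exact h
  have pol2 : conj (∫ z in ModularGroup.fd, f z) * (∫ z in ModularGroup.fd, g z) =
      (((‖∫ z in ModularGroup.fd, (f + g) z‖ : ℂ)) ^ 2 -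
        ((‖∫ z in ModularGroup.fd, (f - g) z‖ : ℂ)) ^ 2 +
        (((‖∫ z in ModularGroup.fd, (f - Complex.I • g) z‖ : ℂ)) ^ 2 -
          ((‖∫ z in ModularGroup.fd, (f + Complex.I • g) z‖ : ℂ)) ^ 2) * Complex.I) / 4 := by
    rw [i1, i2, i3, i4]
    exact conj_mul_eq_polar _ _
  have pol3 : ⟪P𝓒 F, P𝓒 G⟫_ℂ =
      (((‖P𝓒 (F + G)‖ : ℂ)) ^ 2 - ((‖P𝓒 (F - G)‖ : ℂ)) ^ 2 +
        (((‖P𝓒 (F - Complex.I • G)‖ : ℂ)) ^ 2 - ((‖P𝓒 (F + Complex.I • G)‖ : ℂ)) ^ 2) *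
          Complex.I) / 4 := by
    have h := inner_eq_sum_norm_sq_div_four (𝕜 := ℂ) (P𝓒 F) (P𝓒 G)
    simp only [RCLike.I_to_complex] at h
    rw [map_add, map_sub, map_sub, map_add, map_smul]
    exact h
  have pol4 : (∫ r : ℝ, conj (eisenCoeff f r) * eisenCoeff g r) =
      (((‖Cf + Cg‖ : ℂ)) ^ 2 - ((‖Cf - Cg‖ : ℂ)) ^ 2 +
        (((‖Cf - Complex.I • Cg‖ : ℂ)) ^ 2 - ((‖Cf + Complex.I • Cg‖ : ℂ)) ^ 2) * Complex.I) / 4 := by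
    rw [← inner_toLp_toLp_eq_integral hcf hcg, ← hCf, ← hCg]
    have h := inner_eq_sum_norm_sq_div_four (𝕜 := ℂ) Cf Cg
    simp only [RCLike.I_to_complex] at h
    exact h
  -- norms of classes are integrals
  have n1 := norm_toLp_sq_eq_integral_complex (hf2.add hg2)
  have n2 := norm_toLp_sq_eq_integral_complex (hf2.sub hg2)
  have n3 := norm_toLp_sq_eq_integral_complex (hf2.sub hI2)
  have n4 := norm_toLp_sq_eq_integral_complex (hf2.add hI2)
  rw [c1] at n1; rw [c2] at n2; rw [c3] at n3; rw [c4] at n4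
  have m1 := norm_toLp_sq_eq_integral_complex hc1
  have m2 := norm_toLp_sq_eq_integral_complex hc2
  have m3 := norm_toLp_sq_eq_integral_complex hc3
  have m4 := norm_toLp_sq_eq_integral_complex hc4
  rw [d1] at m1; rw [d2] at m2; rw [d3] at m3; rw [d4] at m4
  -- Parseval identities as complex equalities
  have E1' := congrArg (fun x : ℝ => (x : ℂ)) E1
  have E2' := congrArg (fun x : ℝ => (x : ℂ)) E2
  have E3' := congrArg (fun x : ℝ => (x : ℂ)) E3
  have E4' := congrArg (fun x : ℝ => (x : ℂ)) E4
  push_cast at E1' E2' E3' E4'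
  rw [c1] at E1'; rw [c2] at E2'; rw [c3] at E3'; rw [c4] at E4'
  rw [pol1, pol2, pol3, pol4, n1, n2, n3, n4, m1, m2, m3, m4]
  linear_combination (E1' - E2' + (E3' - E4') * Complex.I) / 4

end Polarization

/-! ## 4. Automorphic kernels as test functions on `𝒟`, and their spectral coefficients -/

section KernelTest

variable {k : ℝ → ℝ}

/-- Heights in a modular orbit: `Im(g w) = Im w` (if `c = 0`) or `Im(g w) ≤ 1/Im w` (if `c ≠ 0`,
as `|cw + d|² ≥ c² (Im w)² ≥ (Im w)²`). [folklore] -/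
theorem im_modular_smul_eq_or_le (g : SL(2, ℤ)) (w : ℍ) :
    (g • w).im = w.im ∨ (g • w).im ≤ w.im⁻¹ := by
  rw [ModularGroup.im_smul_eq_div_normSq]
  have hpos := normSq_denom_pos (↑g : GL (Fin 2) ℝ) w.im_ne_zero
  by_cases hc : (g : Matrix (Fin 2) (Fin 2) ℤ) 1 0 = 0
  · have hdet := Matrix.SpecialLinearGroup.det_coe g
    rw [Matrix.det_fin_two, hc, mul_zero, sub_zero] at hdet
    have hd : (g : Matrix (Fin 2) (Fin 2) ℤ) 1 1 = 1 ∨ (g : Matrix (Fin 2) (Fin 2) ℤ) 1 1 = -1 :=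
      Int.eq_one_or_neg_one_of_mul_eq_one' hdet |>.elim (fun h => Or.inl h.2) (fun h => Or.inr h.2)
    have hnorm : Complex.normSq (denom (↑g : GL (Fin 2) ℝ) w) = 1 := by
      rw [ModularGroup.denom_apply, hc]
      rcases hd with hd | hd <;> simp [hd]
    left
    rw [hnorm, div_one]
  · have hle : w.im ^ 2 ≤ Complex.normSq (denom (↑g : GL (Fin 2) ℝ) w) := by
      have hc2 : (1 : ℝ) ≤ ((g : Matrix (Fin 2) (Fin 2) ℤ) 1 0 : ℝ) ^ 2 := by
        have : (1 : ℤ) ≤ ((g : Matrix (Fin 2) (Fin 2) ℤ) 1 0) ^ 2 := by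
          have h0 : ((g : Matrix (Fin 2) (Fin 2) ℤ) 1 0) ^ 2 ≠ 0 := pow_ne_zero 2 hc
          have h1 : 0 ≤ ((g : Matrix (Fin 2) (Fin 2) ℤ) 1 0) ^ 2 := sq_nonneg _
          omega
        exact_mod_cast this
      have h := UpperHalfPlane.c_mul_im_sq_le_normSq_denom (↑g : GL (Fin 2) ℝ) w
      have e : ((↑g : GL (Fin 2) ℝ) 1 0 : ℝ) = ((g : Matrix (Fin 2) (Fin 2) ℤ) 1 0 : ℝ) := by
        simp
      rw [e] at h
      nlinarith [sq_nonneg w.im, w.im_pos]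
    right
    calc w.im / Complex.normSq (denom (↑g : GL (Fin 2) ℝ) w) ≤ w.im / w.im ^ 2 :=
          div_le_div_of_nonneg_left w.im_pos.le (by positivity) hle
      _ = w.im⁻¹ := by have := w.im_pos; field_simp

/-- `u(w, z) ≥ (Im w - Im z)² / (4 Im w Im z)`. [folklore] -/
theorem sq_div_le_pointPairInv (w z : ℍ) :
    (w.im - z.im) ^ 2 / (4 * w.im * z.im) ≤ pointPairInv w z := by
  rw [pointPairInv_eq_coord]
  have hw := w.im_pos
  have hz := z.im_pos
  apply div_le_div_of_nonneg_right _ (by positivity)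
  nlinarith [sq_nonneg (z.re - w.re)]

/-- Points much higher than `z` are far from `z`: `Im w ≥ (2 + 16M) Im z ⇒ u(w, z) ≥ M`. [folklore] -/
theorem le_pointPairInv_of_im_ge {z w : ℍ} {M : ℝ} (hM : 0 ≤ M)
    (h : 2 * z.im + 16 * M * z.im ≤ w.im) : M ≤ pointPairInv w z := by
  refine le_trans ?_ (sq_div_le_pointPairInv w z)
  have ha := z.im_pos
  have hy := w.im_pos
  rw [le_div_iff₀ (by positivity)]
  have h1 : w.im / 2 ≤ w.im - z.im := by nlinarith
  have h2 : 16 * M * z.im ≤ w.im - z.im := by linarith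
  have h3 : w.im / 2 * (16 * M * z.im) ≤ (w.im - z.im) * (w.im - z.im) :=
    mul_le_mul h1 h2 (by positivity) (by linarith)
  nlinarith

/-- Points much lower than `z` are far from `z`: `(2 + 16M) Im w ≤ Im z ⇒ u(w, z) ≥ M`. [folklore] -/
theorem le_pointPairInv_of_im_le {z w : ℍ} {M : ℝ} (hM : 0 ≤ M)
    (h : w.im * (2 + 16 * M) ≤ z.im) : M ≤ pointPairInv w z := by
  refine le_trans ?_ (sq_div_le_pointPairInv w z)
  have ha := z.im_pos
  have hy := w.im_pos
  rw [le_div_iff₀ (by positivity)]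
  have h1 : z.im / 2 ≤ z.im - w.im := by nlinarith
  have h2 : 16 * M * w.im ≤ z.im - w.im := by nlinarith
  have h3 : z.im / 2 * (16 * M * w.im) ≤ (z.im - w.im) * (z.im - w.im) :=
    mul_le_mul h1 h2 (by positivity) (by linarith)
  nlinarith

/-- **Automorphic kernels vanish high in the cusp**: for a test kernel `k` (supported in `[0, M]`)
and `z ∈ ℍ` there is a height `Y` with `K(w, z) = 0` whenever `Im w ≥ Y` — every `γ w`,
`γ ∈ SL₂(ℤ)`, has height `Im w` or `≤ 1/Im w`, hence `u(γ w, z) ≥ M`. [folklore] -/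
theorem exists_automorphicKernel_eq_zero_of_le_im (hk : IsTestKernel k) (z : ℍ) :
    ∃ Y : ℝ, 0 < Y ∧ ∀ w : ℍ, Y ≤ w.im → automorphicKernel Γℤ k w z = 0 := by
  obtain ⟨_, _, ⟨M, hM0, hM⟩⟩ := hk
  have ha := z.im_pos
  set Y : ℝ := max (2 * z.im + 16 * M * z.im) ((2 + 16 * M) / z.im) with hY
  have hY0 : 0 < Y := lt_of_lt_of_le (by positivity) (le_max_right _ _)
  refine ⟨Y, hY0, fun w hw => ?_⟩
  rw [← tsum_kernel_eq_automorphicKernel modular_le_range_toGL isDiscreteSubgroup_modular hM w z]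
  have hzero : ∀ γ : Γℤ, k (pointPairInv ((γ : GL (Fin 2) ℝ) • w) z) = 0 := by
    intro γ
    apply hM
    obtain ⟨g, hg⟩ := γ.2
    have e : ((γ : GL (Fin 2) ℝ)) • w = g • w := by rw [← hg]; rfl
    rw [e]
    rcases im_modular_smul_eq_or_le g w with h | h
    · refine le_pointPairInv_of_im_ge hM0 ?_
      rw [h]
      exact (le_max_left _ _).trans hw
    · refine le_pointPairInv_of_im_le hM0 ?_
      have hw' : (2 + 16 * M) / z.im ≤ w.im := (le_max_right _ _).trans hw
      have hwpos : 0 < w.im := w.im_pos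
      have h1 : w.im⁻¹ ≤ z.im / (2 + 16 * M) := by
        rw [inv_le_comm₀ hwpos (by positivity), inv_div]
        exact hw'
      have h2 : (g • w).im ≤ z.im / (2 + 16 * M) := h.trans h1
      have := mul_le_mul_of_nonneg_right h2 (by positivity : (0 : ℝ) ≤ 2 + 16 * M)
      rwa [div_mul_cancel₀ _ (by positivity)] at this
  simp [hzero]

/-- The same for `K(z, ·)` (symmetry of the automorphic kernel). [folklore] -/
theorem exists_automorphicKernel_eq_zero_of_le_im' (hk : IsTestKernel k) (z : ℍ) :
    ∃ Y : ℝ, 0 < Y ∧ ∀ w : ℍ, Y ≤ w.im → automorphicKernel Γℤ k z w = 0 := by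
  obtain ⟨_, _, ⟨M, _, hM⟩⟩ := id hk
  obtain ⟨Y, hY0, hY⟩ := exists_automorphicKernel_eq_zero_of_le_im hk z
  refine ⟨Y, hY0, fun w hw => ?_⟩
  rw [automorphicKernel_comm modular_le_range_toGL isDiscreteSubgroup_modular hM z w]
  exact hY w hw

/-- **`K(·, z)` is a test function on `𝒟`** for a continuous test kernel. [folklore] -/
theorem isFdTest_automorphicKernel (hk : IsTestKernel k) (hkc : Continuous k) (z : ℍ) :
    IsFdTest (fun w => (automorphicKernel Γℤ k w z : ℂ)) := by
  have hcont : Continuous fun w => (automorphicKernel Γℤ k w z : ℂ) :=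
    Complex.continuous_ofReal.comp
      (continuous_automorphicKernel_left modular_le_range_toGL isDiscreteSubgroup_modular hk hkc z)
  obtain ⟨Y, _, hY⟩ := exists_automorphicKernel_eq_zero_of_le_im hk z
  obtain ⟨C, hC⟩ := (isCompact_fdTrunc Y).exists_bound_of_continuousOn hcont.continuousOn
  refine ⟨hcont.aestronglyMeasurable, ⟨max C 0, fun w hw => ?_⟩, ⟨Y, fun w _ hw => by simp [hY w hw]⟩⟩
  by_cases hwY : w.im ≤ Y
  · exact (hC w ⟨hw, hwY⟩).trans (le_max_left _ _)
  · rw [hY w (le_of_lt (not_le.mp hwY))]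
    simp

/-- Monotonicity of the automorphic kernel in the kernel function: `0 ≤ k₁ ≤ k₂` pointwise gives
`K_{k₁} ≤ K_{k₂}`. [folklore] -/
theorem automorphicKernel_mono {k₁ k₂ : ℝ → ℝ} {M : ℝ} (hM : ∀ u, M ≤ u → k₂ u = 0)
    (h0 : ∀ u, 0 ≤ k₁ u) (hle : ∀ u, k₁ u ≤ k₂ u) (z w : ℍ) :
    automorphicKernel Γℤ k₁ z w ≤ automorphicKernel Γℤ k₂ z w := by
  have hM1 : ∀ u, M ≤ u → k₁ u = 0 := fun u hu => le_antisymm (by rw [← hM u hu]; exact hle u) (h0 u)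
  have hS := finite_hypBall modular_le_range_toGL isDiscreteSubgroup_modular z w M
  rw [automorphicKernel_eq_sum hM1 z w hS (fun γ hγ => hγ.1) (fun γ hγ hlt => ⟨hγ, hlt.le⟩),
    automorphicKernel_eq_sum hM z w hS (fun γ hγ => hγ.1) (fun γ hγ hlt => ⟨hγ, hlt.le⟩)]
  exact Finset.sum_le_sum fun γ _ => hle _

/-- **`K(·, z)` is a test function on `𝒟`** for the discontinuous kernel `𝟙_{[0,δ]}` of the proof of
Proposition 7.2 (measurable; `0 ≤ K_{𝟙_{[0,δ]}} ≤ K_{k}` for a smooth `k ≥ 𝟙_{[0,δ]}`). [folklore] -/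
theorem isFdTest_automorphicKernel_ballKernel {δ : ℝ} (hδ : 0 ≤ δ) (z : ℍ) :
    IsFdTest (fun w => (automorphicKernel Γℤ (ballKernel δ) w z : ℂ)) := by
  have hΓ := modular_le_range_toGL
  have hd := isDiscreteSubgroup_modular
  -- the smooth majorant `k = k_{1,δ}`
  have hk := isTestKernel_stKernel one_pos hδ
  obtain ⟨B, hB⟩ := (isFdTest_automorphicKernel hk (continuous_stKernel 1 δ) z).bounded
  have hM : ∀ u, δ + 1 / 1 ≤ u → stKernel 1 δ u = 0 := fun u hu => stKernel_eq_zero one_pos hu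
  have hle : ∀ w, automorphicKernel Γℤ (ballKernel δ) w z ≤ automorphicKernel Γℤ (stKernel 1 δ) w z :=
    fun w => automorphicKernel_mono hM (ballKernel_nonneg δ) (fun u => by
      by_cases hu : u ≤ δ
      · rw [ballKernel_of_le hu, stKernel_eq_one zero_le_one hu]
      · rw [ballKernel_of_gt (not_le.mp hu)]; exact stKernel_nonneg _ _ _) w z
  obtain ⟨Y, _, hY⟩ := exists_automorphicKernel_eq_zero_of_le_im (isTestKernel_ballKernel hδ) z
  refine ⟨(Complex.measurable_ofReal.comp (measurable_automorphicKernel_ballKernel hΓ hd z)).aestronglyMeasurable,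
    ⟨B, fun w hw => ?_⟩, ⟨Y, fun w _ hw => by simp [hY w hw]⟩⟩
  have h0 := automorphicKernel_ballKernel_nonneg hΓ hd (δ := δ) w z
  rw [Complex.norm_real, Real.norm_of_nonneg h0]
  refine (hle w).trans ?_
  have := hB w hw
  rw [Complex.norm_real, Real.norm_eq_abs] at this
  exact (le_abs_self _).trans this

/-! ### The spectral coefficients of `K(·, z)` -/

/-- `h(t)` is real for real `t` (and a real kernel): `conj h(t) = h(-t) = h(t)`. [folklore] -/
theorem conj_selbergTransform_ofReal (k : ℝ → ℝ) (t : ℝ) :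
    conj (selbergTransform k t) = selbergTransform k t := by
  conv_rhs => rw [← selbergTransform_neg]
  unfold selbergTransform
  rw [← integral_conj]
  congr 1 with r
  rw [map_mul, Complex.conj_ofReal, ← Complex.exp_conj]
  congr 2
  simp only [map_mul, Complex.conj_I, Complex.conj_ofReal]
  ring

/-- The mass of `K(·, z)` on `𝒟`: `∫_𝒟 K(w, z) dμ(w) = 2 h(i/2) = 2 · 4π ∫_0^∞ k` (unfolding, the
constant eigenfunction). [cite: Iwaniec2002, §7.2, PDF p. 73] -/
theorem setIntegral_fd_automorphicKernel (hk : IsTestKernel k) (z : ℍ) :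
    ∫ w in ModularGroup.fd, (automorphicKernel Γℤ k w z : ℂ) =
      2 * ((4 * π * ∫ u in Ioi 0, k u : ℝ) : ℂ) := by
  obtain ⟨_, _, ⟨M, _, hM⟩⟩ := id hk
  have h := setIntegral_automorphicKernel_mul modular_le_range_toGL neg_one_mem_modular
    isDiscreteSubgroup_modular isHypFundamentalDomain_modular_fd hk (isAutomorphic_const Γℤ (1 : ℂ))
    (locallyIntegrable_const (1 : ℂ)) z
  simp only [mul_one] at h
  rw [invariantOperator_const hk 1 z, mul_one] at h
  rw [← h]
  refine setIntegral_congr_fun isHypFundamentalDomain_modular_fd.measurableSet fun w _ => ?_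
  rw [automorphicKernel_comm modular_le_range_toGL isDiscreteSubgroup_modular hM w z]

/-- **The cuspidal coefficients** `⟨u, K(·, z)⟩ = 2 h(t) ū(z)` for an automorphic `C²` eigenfunction
with real spectral parameter (Theorem 1.16 and unfolding). [cite: Iwaniec2002, §7.4, PDF p. 76] -/
theorem setIntegral_fd_conj_mul_automorphicKernel (hk : IsTestKernel k) {u : ℍ → ℂ}
    (hua : IsAutomorphic Γℤ u) (huc : IsC2 u) (t : ℝ)
    (heig : ∀ z, hypLaplacian u z + (1 / 4 + (t : ℂ) ^ 2) * u z = 0) (z : ℍ) :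
    ∫ w in ModularGroup.fd, conj (u w) * (automorphicKernel Γℤ k w z : ℂ) =
      2 * selbergTransform k t * conj (u z) := by
  rw [← setIntegral_automorphicKernel_mul_conj modular_le_range_toGL neg_one_mem_modular
    isDiscreteSubgroup_modular isHypFundamentalDomain_modular_fd hk hua huc t heig z]
  congr 1 with w
  ring

/-- **The Eisenstein coefficients** `⟨E(·, 1/2 + ir), K(·, z)⟩ = 2 h(r) Ē(z, 1/2 + ir)`
(Theorem 1.16 for `E`, unfolding, and `h(r) ∈ ℝ`). [cite: Iwaniec2002, §7.4, PDF p. 76] -/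
theorem eisenCoeff_automorphicKernel (hk : IsTestKernel k) (z : ℍ) (r : ℝ) :
    eisenCoeff (fun w => (automorphicKernel Γℤ k w z : ℂ)) r =
      2 * selbergTransform k r * conj (eisensteinCrit z r) := by
  obtain ⟨_, _, ⟨M, _, hM⟩⟩ := id hk
  have h := setIntegral_automorphicKernel_mul modular_le_range_toGL neg_one_mem_modular
    isDiscreteSubgroup_modular isHypFundamentalDomain_modular_fd hk (isAutomorphic_eisensteinCrit r)
    (isC2_and_eigen_eisensteinCrit r).1.continuous.locallyIntegrable z
  rw [invariantOperator_eisensteinCrit hk r z] at h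
  unfold eisenCoeff
  have e : (fun w => conj (eisensteinCrit w r) * (automorphicKernel Γℤ k w z : ℂ)) =
      fun w => conj ((automorphicKernel Γℤ k z w : ℂ) * eisensteinCrit w r) := by
    funext w
    rw [map_mul, Complex.conj_ofReal, automorphicKernel_comm modular_le_range_toGL
      isDiscreteSubgroup_modular hM w z]
    ring
  rw [e, integral_conj, h, map_mul, map_mul, conj_selbergTransform_ofReal,
    show (starRingEnd ℂ) (2 : ℂ) = 2 from by
      rw [show (2 : ℂ) = ((2 : ℝ) : ℂ) by norm_num, Complex.conj_ofReal]]
  ring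

end KernelTest

/-! ## 5. The local Weyl law for the Eisenstein series (Proposition 7.2, continuous half) -/

section EisensteinWeyl

/-- **Proposition 7.2 for the Eisenstein series of `SL₂(ℤ)` from the Parseval identity**: for every
`z` there is `A` with `∫_{-T}^{T} |E(z, 1/2 + it)|² dt ≤ A T²` for `T ≥ 1` — Bessel's inequality
(7.8)–(7.9) (here: `(1/4π) ∫ |c_F|² ≤ ‖F‖²`, a consequence of Parseval) for `F = K(·, z)` with the
kernel `𝟙_{[0,δ]}`, `δ = (64T)⁻²`, the coefficients `c_F(r) = 2h(r) Ē(z, 1/2 + ir)` with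
`|h(r)| ≥ 2πδ` for `|r| ≤ T`, and `‖F‖² ≤ 8πδ N_δ(z)` by unfolding; `A = 8192 N(z)`,
`N(z) = N_{1/4096}(z)` the orbit count of `LocalWeylLaw.lean`.
[cite: Iwaniec2002, Prop. 7.2 (7.10) & its proof, PDF pp. 72–73] -/
theorem eisenstein_localWeyl_of_parseval (h73 : ∀ f : ℍ → ℂ, IsFdTest f → HasModularParseval f) (z : ℍ) :
    ∃ A : ℝ, ∀ T : ℝ, 1 ≤ T → ∫ r in (-T)..T, ‖eisensteinCrit z r‖ ^ 2 ≤ A * T ^ 2 := by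
  have hΓ := modular_le_range_toGL
  have hneg := neg_one_mem_modular
  have hd := isDiscreteSubgroup_modular
  have hF := isHypFundamentalDomain_modular_fd
  refine ⟨8192 * orbitCount Γℤ (1 / 4096) z, fun T hT => ?_⟩
  -- the parameter δ = (64 T)⁻²
  set δ : ℝ := ((64 * T) ^ 2)⁻¹ with hδdef
  have hT0 : 0 < T := by linarith
  have hδ : 0 < δ := by rw [hδdef]; positivity
  have hδ' : δ ≤ 1 / 4096 := by
    rw [hδdef, inv_le_comm₀ (by positivity) (by norm_num)]
    nlinarith
  have hsq : Real.sqrt δ = (64 * T)⁻¹ := by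
    rw [hδdef, Real.sqrt_inv, Real.sqrt_sq (by positivity)]
  have hk := isTestKernel_ballKernel hδ.le
  set Ff : ℍ → ℂ := fun w => (automorphicKernel Γℤ (ballKernel δ) w z : ℂ) with hFf
  have hFt : IsFdTest Ff := isFdTest_automorphicKernel_ballKernel hδ.le z
  obtain ⟨hcL2, hP⟩ := (⟨(h73 Ff hFt).memLp_eisenCoeff, (h73 Ff hFt).norm_sq_eq hFt.memLp_two⟩ : _ ∧ _)
  -- ‖F‖² ≤ 2 N_δ 4πδ
  obtain ⟨_, hKint⟩ := memLp_automorphicKernel_ballKernel hΓ hneg hd hF hδ.le z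
  -- Bessel: (1/4π) ∫ |c_F|² ≤ ∫ |F|²
  have hI0 : 0 ≤ ∫ r : ℝ, ‖eisenCoeff Ff r‖ ^ 2 := integral_nonneg fun r => by positivity
  have hBessel : 1 / (4 * π) * ∫ r : ℝ, ‖eisenCoeff Ff r‖ ^ 2 ≤ 2 * orbitCount Γℤ δ z * (4 * π * δ) := by
    have h1 : 0 ≤ 3 / π * ‖∫ w in ModularGroup.fd, Ff w‖ ^ 2 := by positivity
    have h2 : 0 ≤ ‖cuspSubmodule.orthogonalProjectionOnto (hFt.memLp_two.toLp Ff)‖ ^ 2 := by positivity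
    linarith
  -- the coefficients
  have hcoef : ∀ r : ℝ, ‖eisenCoeff Ff r‖ ^ 2 =
      4 * ‖selbergTransform (ballKernel δ) r‖ ^ 2 * ‖eisensteinCrit z r‖ ^ 2 := by
    intro r
    rw [hFf, eisenCoeff_automorphicKernel hk z r, norm_mul, norm_mul, Complex.norm_two,
      Complex.norm_conj]
    ring
  -- lower bound for h on [-T, T]
  have hh : ∀ r : ℝ, |r| ≤ T → 2 * π * δ ≤ ‖selbergTransform (ballKernel δ) r‖ := by
    intro r hr
    refine norm_selbergTransform_ballKernel_ge hδ (hδ'.trans (by norm_num)) (r : ℂ) ?_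
    have hs : ‖(1 / 2 : ℂ) + Complex.I * (r : ℂ)‖ ≤ 1 / 2 + |r| := by
      calc ‖(1 / 2 : ℂ) + Complex.I * (r : ℂ)‖ ≤ ‖(1 / 2 : ℂ)‖ + ‖Complex.I * (r : ℂ)‖ :=
            norm_add_le _ _
        _ = 1 / 2 + |r| := by
            rw [norm_mul, Complex.norm_I, one_mul, Complex.norm_real, Real.norm_eq_abs]
            norm_num
    rw [hsq]
    have : (1 / 2 + |r|) * (32 * (64 * T)⁻¹) ≤ 1 := by
      rw [show (32 : ℝ) * (64 * T)⁻¹ = (2 * T)⁻¹ by field_simp; ring]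
      rw [mul_inv_le_iff₀ (by positivity)]
      linarith
    exact le_trans (mul_le_mul_of_nonneg_right hs (by positivity)) this
  -- pointwise on [-T, T]: (4πδ)² |E|² ≤ |c_F|²
  have hpt : ∀ r ∈ Set.Icc (-T) T,
      (4 * π * δ) ^ 2 * ‖eisensteinCrit z r‖ ^ 2 ≤ ‖eisenCoeff Ff r‖ ^ 2 := by
    intro r hr
    have hrT : |r| ≤ T := abs_le.mpr ⟨hr.1, hr.2⟩
    rw [hcoef r]
    have h1 := hh r hrT
    have h2 : (2 * π * δ) ^ 2 ≤ ‖selbergTransform (ballKernel δ) r‖ ^ 2 :=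
      pow_le_pow_left₀ (by positivity) h1 2
    nlinarith [norm_nonneg (eisensteinCrit z r), sq_nonneg ‖eisensteinCrit z r‖]
  -- integrate over [-T, T]
  have hcint : Integrable (fun r : ℝ => ‖eisenCoeff Ff r‖ ^ 2) :=
    (memLp_two_iff_integrable_sq_norm hcL2.1).mp hcL2
  have hEcont : Continuous fun r : ℝ => ‖eisensteinCrit z r‖ ^ 2 :=
    (continuous_eisensteinCrit z).norm.pow 2
  have hint1 : ∫ r in (-T)..T, (4 * π * δ) ^ 2 * ‖eisensteinCrit z r‖ ^ 2 ≤
      ∫ r in (-T)..T, ‖eisenCoeff Ff r‖ ^ 2 :=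
    intervalIntegral.integral_mono_on (by linarith) ((hEcont.const_mul _).intervalIntegrable _ _)
      hcint.intervalIntegrable (fun r hr => hpt r hr)
  have hint2 : ∫ r in (-T)..T, ‖eisenCoeff Ff r‖ ^ 2 ≤ ∫ r : ℝ, ‖eisenCoeff Ff r‖ ^ 2 := by
    rw [intervalIntegral.integral_of_le (by linarith)]
    exact setIntegral_le_integral hcint (Eventually.of_forall fun r => by positivity)
  rw [intervalIntegral.integral_const_mul] at hint1
  -- combine
  have hN : (orbitCount Γℤ δ z : ℝ) ≤ orbitCount Γℤ (1 / 4096) z := by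
    exact_mod_cast orbitCount_mono hΓ hd hδ.le hδ' z
  have hπ := Real.pi_pos
  -- (4πδ)² ∫|E|² ≤ 4π · 2N 4πδ
  have key : (4 * π * δ) ^ 2 * ∫ r in (-T)..T, ‖eisensteinCrit z r‖ ^ 2 ≤
      4 * π * (2 * orbitCount Γℤ δ z * (4 * π * δ)) := by
    have h1 := hint1.trans hint2
    have h2 : ∫ r : ℝ, ‖eisenCoeff Ff r‖ ^ 2 ≤ 4 * π * (2 * orbitCount Γℤ δ z * (4 * π * δ)) := by
      have := mul_le_mul_of_nonneg_left hBessel (by positivity : (0 : ℝ) ≤ 4 * π)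
      rwa [← mul_assoc, show 4 * π * (1 / (4 * π)) = 1 by field_simp, one_mul] at this
    exact h1.trans h2
  have hδT : δ⁻¹ = 4096 * T ^ 2 := by rw [hδdef, inv_inv]; ring
  have key2 : ∫ r in (-T)..T, ‖eisensteinCrit z r‖ ^ 2 ≤ 2 * orbitCount Γℤ δ z * δ⁻¹ := by
    rw [← sub_nonneg]
    have e : 2 * (orbitCount Γℤ δ z : ℝ) * δ⁻¹ - ∫ r in (-T)..T, ‖eisensteinCrit z r‖ ^ 2 =
        ((4 * π) ^ 2 * δ ^ 2)⁻¹ * (4 * π * (2 * orbitCount Γℤ δ z * (4 * π * δ)) -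
          (4 * π * δ) ^ 2 * ∫ r in (-T)..T, ‖eisensteinCrit z r‖ ^ 2) := by
      field_simp
    rw [e]
    exact mul_nonneg (by positivity) (by linarith)
  calc ∫ r in (-T)..T, ‖eisensteinCrit z r‖ ^ 2 ≤ 2 * orbitCount Γℤ δ z * δ⁻¹ := key2
    _ = 8192 * orbitCount Γℤ δ z * T ^ 2 := by rw [hδT]; ring
    _ ≤ 8192 * orbitCount Γℤ (1 / 4096) z * T ^ 2 := by gcongr

end EisensteinWeyl

/-! ## 6. An approximate identity of point-pair invariants -/

section ApproximateIdentity

variable {k : ℝ → ℝ}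

/-- Scaling a test kernel gives a test kernel. [folklore] -/
theorem IsTestKernel.const_mul (hk : IsTestKernel k) (c : ℝ) : IsTestKernel fun u => c * k u := by
  obtain ⟨hm, ⟨B, hB⟩, ⟨M, hM0, hM⟩⟩ := hk
  refine ⟨hm.const_mul c, ⟨|c| * B, fun u => ?_⟩, ⟨M, hM0, fun u hu => by rw [hM u hu, mul_zero]⟩⟩
  rw [abs_mul]
  exact mul_le_mul_of_nonneg_left (hB u) (abs_nonneg _)

/-- `g` is integrable for a test kernel. [folklore] -/
theorem integrable_selbergG (hk : IsTestKernel k) : Integrable (selbergG k) := by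
  obtain ⟨hm, ⟨B, hB⟩, ⟨M, hM0, hM⟩⟩ := hk
  have h := integrable_mul_selbergG hm hB hM hM0 (continuous_const (y := (1 : ℝ)))
  simpa using h

/-- For a non-negative test kernel, `∫_ℝ g ≤ ∫_ℝ cosh(r/2) g(r) dr = h(i/2) = 4π ∫_0^∞ k`. [folklore] -/
theorem integral_selbergG_le (hk : IsTestKernel k) (h0 : ∀ u, 0 ≤ k u) :
    ∫ r, selbergG k r ≤ 4 * π * ∫ u in Ioi 0, k u := by
  obtain ⟨hm, ⟨B, hB⟩, ⟨M, hM0, hM⟩⟩ := id hk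
  have hg0 : ∀ r, 0 ≤ selbergG k r := selbergG_nonneg h0
  have hint := integrable_selbergG hk
  -- `∫_ℝ g = ∫_{r > 0} 2 g` by evenness
  have heven : ∫ r, selbergG k r = ∫ r in Ioi 0, 2 * selbergG k r := by
    rw [← setIntegral_univ, ← Iic_union_Ioi (a := (0 : ℝ)),
      setIntegral_union (Iic_disjoint_Ioi le_rfl) measurableSet_Ioi hint.integrableOn hint.integrableOn]
    have h1 : ∫ r in Iic 0, selbergG k r = ∫ r in Ioi 0, selbergG k r := by
      rw [show Iic (0 : ℝ) = Iic (-0) by rw [neg_zero], ← integral_comp_neg_Ioi]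
      congr 1 with r
      rw [selbergG_neg]
    rw [h1, ← two_mul, ← integral_const_mul]
  -- `∫_{r>0} 2 g ≤ ∫_{r>0} 2 cosh(r/2) g = 4π ∫ k`
  have h2 : ∫ r in Ioi 0, 2 * selbergG k r ≤ ∫ r in Ioi 0, 2 * Real.cosh (r / 2) * selbergG k r := by
    refine setIntegral_mono_on ((hint.const_mul 2).integrableOn) ?_ measurableSet_Ioi fun r _ => ?_
    · exact (integrable_mul_selbergG hm hB hM hM0 (by fun_prop)).integrableOn
    · have hc : 1 ≤ Real.cosh (r / 2) := Real.one_le_cosh _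
      nlinarith [hg0 r]
  rw [heven]
  refine h2.trans (le_of_eq ?_)
  rw [integral_cosh_mul_selbergG, integral_selbergQ_mul_rpow hm hB hM]
  ring

/-- **`|h(t)| ≤ h(i/2) = 4π ∫_0^∞ k` for real `t` and `k ≥ 0`** (`|h(t)| ≤ ∫ |g| = ∫ g ≤ ∫ cosh(r/2) g`).
[folklore] -/
theorem norm_selbergTransform_le_of_nonneg (hk : IsTestKernel k) (h0 : ∀ u, 0 ≤ k u) (t : ℝ) :
    ‖selbergTransform k t‖ ≤ 4 * π * ∫ u in Ioi 0, k u := by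
  have hg0 : ∀ r, 0 ≤ selbergG k r := selbergG_nonneg h0
  unfold selbergTransform
  calc ‖∫ r : ℝ, Complex.exp (Complex.I * r * t) * (selbergG k r : ℂ)‖
      ≤ ∫ r : ℝ, ‖Complex.exp (Complex.I * r * t) * (selbergG k r : ℂ)‖ := norm_integral_le_integral_norm _
    _ = ∫ r : ℝ, selbergG k r := by
        congr 1 with r
        rw [norm_mul, show Complex.I * (r : ℂ) * (t : ℂ) = ((r * t : ℝ) : ℂ) * Complex.I by push_cast; ring,
          Complex.norm_exp_ofReal_mul_I, one_mul, Complex.norm_real, Real.norm_of_nonneg (hg0 r)]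
    _ ≤ 4 * π * ∫ u in Ioi 0, k u := integral_selbergG_le hk h0

/-- **The approximate identity** `k_n = m_{n+1}⁻¹ k'_{n+1}`: smooth, `≥ 0`, supported in `[0, 1/(n+1)]`,
of hyperbolic mass `4π ∫ k_n = 1`. [folklore] -/
def bump (n : ℕ) (u : ℝ) : ℝ := (cutMass (n + 1))⁻¹ * cutKernel (n + 1) u

/-- `k_n` is a test kernel. [folklore] -/
theorem isTestKernel_bump (n : ℕ) : IsTestKernel (bump n) :=
  (isTestKernel_stKernel (Nat.cast_add_one_pos n) le_rfl).const_mul _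

/-- `k_n` is continuous. [folklore] -/
theorem continuous_bump (n : ℕ) : Continuous (bump n) :=
  continuous_const.mul (continuous_stKernel _ _)

/-- `k_n ≥ 0`. [folklore] -/
theorem bump_nonneg (n : ℕ) (u : ℝ) : 0 ≤ bump n u :=
  mul_nonneg (inv_nonneg.mpr (cutMass_pos (Nat.cast_add_one_pos n)).le) (stKernel_nonneg _ _ _)

/-- `k_n(u) = 0` for `u ≥ 1/(n+1)`. [folklore] -/
theorem bump_eq_zero {n : ℕ} {u : ℝ} (hu : 1 / ((n : ℝ) + 1) ≤ u) : bump n u = 0 := by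
  unfold bump cutKernel
  rw [stKernel_eq_zero (Nat.cast_add_one_pos n) (by rw [zero_add]; exact hu), mul_zero]

/-- The mass normalisation `4π ∫_0^∞ k_n = 1`. [folklore] -/
theorem integral_bump (n : ℕ) : 4 * π * ∫ u in Ioi 0, bump n u = 1 := by
  unfold bump
  rw [integral_const_mul]
  have h := cutMass_pos (Nat.cast_add_one_pos n)
  unfold cutMass at h ⊢
  have h' : (∫ u in Ioi 0, cutKernel ((n : ℝ) + 1) u) ≠ 0 := by
    intro h0; rw [h0, mul_zero] at h; exact lt_irrefl _ h
  field_simp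

/-- `h_n(i/2) = 1`. [folklore] -/
theorem selbergTransform_bump_I_half (n : ℕ) : selbergTransform (bump n) (Complex.I / 2) = 1 := by
  rw [selbergTransform_I_half (isTestKernel_bump n), integral_bump]
  simp

/-- `∫_ℍ k_n(u(z, w)) dμ(w) = 1`. [folklore] -/
theorem integral_bump_pointPairInv (n : ℕ) (z : ℍ) :
    ∫ w : ℍ, (bump n (pointPairInv z w) : ℂ) = 1 := by
  rw [integral_kernel_eq (isTestKernel_bump n) z, integral_bump]
  simp

/-- `|h_n(t)| ≤ 1` for real `t`. [folklore] -/
theorem norm_selbergTransform_bump_le (n : ℕ) (t : ℝ) : ‖selbergTransform (bump n) t‖ ≤ 1 := by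
  have h := norm_selbergTransform_le_of_nonneg (isTestKernel_bump n) (bump_nonneg n) t
  rwa [integral_bump] at h

/-- The support radius `r_n = 2 arsinh √(1/(n+1))` of `k_n ∘ u` and of `g_n` tends to `0`. [folklore] -/
theorem tendsto_supportRadius :
    Tendsto (fun n : ℕ => 2 * Real.arsinh (Real.sqrt (1 / ((n : ℝ) + 1)))) atTop (𝓝 0) := by
  have h1 : Tendsto (fun n : ℕ => 1 / ((n : ℝ) + 1)) atTop (𝓝 0) := tendsto_one_div_add_atTop_nhds_zero_nat
  have hc : Continuous fun x : ℝ => 2 * Real.arsinh (Real.sqrt x) :=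
    continuous_const.mul (Real.continuous_arsinh.comp Real.continuous_sqrt)
  have h2 : Tendsto (fun x : ℝ => 2 * Real.arsinh (Real.sqrt x)) (𝓝 0) (𝓝 (2 * Real.arsinh (Real.sqrt 0))) :=
    hc.tendsto 0
  rw [Real.sqrt_zero, Real.arsinh_zero, mul_zero] at h2
  exact h2.comp h1

/-- **`h_n(t) → 1`** for every real `t`: `h_n(t) - h_n(i/2) = ∫ (e^{irt} - e^{-r/2}) g_n(r) dr`, the
support of `g_n` shrinks to `{0}` and `∫ g_n ≤ 1`. [folklore] -/
theorem tendsto_selbergTransform_bump (t : ℝ) :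
    Tendsto (fun n : ℕ => selbergTransform (bump n) t) atTop (𝓝 1) := by
  rw [Metric.tendsto_atTop]
  intro ε hε
  -- the oscillating factor is continuous and vanishes at `r = 0`
  set ψ : ℝ → ℂ := fun r => Complex.exp (Complex.I * r * t) - Complex.exp (Complex.I * r * (Complex.I / 2)) with hψ
  have hψc : Continuous ψ := by simp only [hψ]; fun_prop
  have hψ0 : ψ 0 = 0 := by simp [hψ]
  obtain ⟨η, hη, hηε⟩ : ∃ η > 0, ∀ r : ℝ, |r| < η → ‖ψ r‖ < ε / 2 := by
    obtain ⟨η, hη, h⟩ := Metric.continuousAt_iff.mp (hψc.continuousAt (x := 0)) (ε / 2) (by positivity)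
    refine ⟨η, hη, fun r hr => ?_⟩
    have := @h r (by simpa [Real.dist_eq] using hr)
    rwa [hψ0, dist_zero_right] at this
  obtain ⟨N, hN⟩ := (Metric.tendsto_atTop.mp tendsto_supportRadius) η hη
  refine ⟨N, fun n hn => ?_⟩
  have hkn := isTestKernel_bump n
  obtain ⟨hm, ⟨B, hB⟩, _⟩ := id hkn
  have hM : ∀ u, 1 / ((n : ℝ) + 1) ≤ u → bump n u = 0 := fun u hu => bump_eq_zero hu
  have hM0 : (0 : ℝ) ≤ 1 / ((n : ℝ) + 1) := by positivity
  have hρ : 2 * Real.arsinh (Real.sqrt (1 / ((n : ℝ) + 1))) < η := by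
    have := hN n hn
    rw [Real.dist_eq, sub_zero, abs_of_nonneg] at this
    · exact this
    · have : 0 ≤ Real.arsinh (Real.sqrt (1 / ((n : ℝ) + 1))) := Real.arsinh_nonneg_iff.mpr (Real.sqrt_nonneg _)
      linarith
  -- `h_n(t) - 1 = ∫ ψ g_n`
  have hdiff : selbergTransform (bump n) t - 1 = ∫ r : ℝ, ψ r * (selbergG (bump n) r : ℂ) := by
    rw [← selbergTransform_bump_I_half n]
    unfold selbergTransform
    rw [← integral_sub (integrable_mul_selbergG_complex hm hB hM hM0 (by fun_prop))
      (integrable_mul_selbergG_complex hm hB hM hM0 (by fun_prop))]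
    congr 1 with r
    simp only [hψ]
    ring
  -- pointwise bound `‖ψ g_n‖ ≤ (ε/2) g_n`
  have hg0 : ∀ r, 0 ≤ selbergG (bump n) r := selbergG_nonneg (bump_nonneg n)
  have hpt : ∀ r : ℝ, ‖ψ r * (selbergG (bump n) r : ℂ)‖ ≤ ε / 2 * selbergG (bump n) r := by
    intro r
    rw [norm_mul, Complex.norm_real, Real.norm_of_nonneg (hg0 r)]
    by_cases hr : |r| < η
    · exact mul_le_mul_of_nonneg_right (hηε r hr).le (hg0 r)
    · rw [selbergG_eq_zero hM hM0 (le_trans hρ.le (not_lt.mp hr))]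
      simp
  rw [dist_eq_norm, hdiff]
  calc ‖∫ r : ℝ, ψ r * (selbergG (bump n) r : ℂ)‖
      ≤ ∫ r : ℝ, ε / 2 * selbergG (bump n) r :=
        norm_integral_le_of_norm_le ((integrable_selbergG hkn).const_mul _) (Eventually.of_forall hpt)
    _ = ε / 2 * ∫ r : ℝ, selbergG (bump n) r := integral_const_mul _ _
    _ ≤ ε / 2 * 1 := by
        gcongr
        have := integral_selbergG_le hkn (bump_nonneg n)
        rwa [integral_bump] at this
    _ < ε := by linarith

/-- **`L_{k_n} U(z) → U(z)`** for continuous `U` (`∫ k_n(u(z,·)) = 1` and the support of `k_n ∘ u`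
shrinks to the point `z`). [folklore] -/
theorem tendsto_invariantOperator_bump {U : ℍ → ℂ} (hU : Continuous U) (z : ℍ) :
    Tendsto (fun n : ℕ => invariantOperator (bump n) U z) atTop (𝓝 (U z)) := by
  rw [Metric.tendsto_atTop]
  intro ε hε
  obtain ⟨η, hη, hηε⟩ : ∃ η > 0, ∀ w : ℍ, dist w z < η → ‖U w - U z‖ < ε / 2 := by
    obtain ⟨η, hη, h⟩ := Metric.continuousAt_iff.mp hU.continuousAt (ε / 2) (by positivity)
    exact ⟨η, hη, fun w hw => by rw [← dist_eq_norm]; exact h hw⟩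
  obtain ⟨N, hN⟩ := (Metric.tendsto_atTop.mp tendsto_supportRadius) η hη
  refine ⟨N, fun n hn => ?_⟩
  have hkn := isTestKernel_bump n
  have hρ : cutRadius ((n : ℝ) + 1) < η := by
    have := hN n hn
    rw [Real.dist_eq, sub_zero, abs_of_nonneg] at this
    · exact this
    · have : 0 ≤ Real.arsinh (Real.sqrt (1 / ((n : ℝ) + 1))) := Real.arsinh_nonneg_iff.mpr (Real.sqrt_nonneg _)
      linarith
  -- `L U(z) - U(z) = ∫ k_n(u(z,w)) (U w - U z)`
  have hint1 : Integrable fun w : ℍ => (bump n (pointPairInv z w) : ℂ) * U w :=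
    integrable_kernel_mul_of_continuous hkn hU z
  have hint2 : Integrable fun w : ℍ => (bump n (pointPairInv z w) : ℂ) * U z :=
    integrable_kernel_mul_of_continuous hkn continuous_const z
  have hdiff : invariantOperator (bump n) U z - U z =
      ∫ w : ℍ, (bump n (pointPairInv z w) : ℂ) * (U w - U z) := by
    have e : U z = ∫ w : ℍ, (bump n (pointPairInv z w) : ℂ) * U z := by
      rw [integral_mul_const, integral_bump_pointPairInv, one_mul]
    conv_lhs => rw [e]
    unfold invariantOperator
    rw [← integral_sub hint1 hint2]
    congr 1 with w
    ring
  have hpt : ∀ w : ℍ, ‖(bump n (pointPairInv z w) : ℂ) * (U w - U z)‖ ≤ bump n (pointPairInv z w) * (ε / 2) := by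
    intro w
    rw [norm_mul, Complex.norm_real, Real.norm_of_nonneg (bump_nonneg n _)]
    by_cases hw : dist z w ≤ cutRadius ((n : ℝ) + 1)
    · refine mul_le_mul_of_nonneg_left (hηε w ?_).le (bump_nonneg n _)
      rw [dist_comm]; exact lt_of_le_of_lt hw hρ
    · have : bump n (pointPairInv z w) = 0 := by
        unfold bump
        rw [cutKernel_pointPairInv_eq_zero (Nat.cast_add_one_pos n) (not_le.mp hw), mul_zero]
      rw [this]; simp
  rw [dist_eq_norm, hdiff]
  have hint3 : Integrable fun w : ℍ => bump n (pointPairInv z w) * (ε / 2) := by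
    have := (integrable_kernel_mul_of_continuous hkn (continuous_const (y := ((ε / 2 : ℝ) : ℂ))) z).re
    refine this.congr (Eventually.of_forall fun w => ?_)
    simp
  calc ‖∫ w : ℍ, (bump n (pointPairInv z w) : ℂ) * (U w - U z)‖
      ≤ ∫ w : ℍ, bump n (pointPairInv z w) * (ε / 2) := norm_integral_le_of_norm_le hint3 (Eventually.of_forall hpt)
    _ = (∫ w : ℍ, bump n (pointPairInv z w)) * (ε / 2) := integral_mul_const _ _
    _ = ε / 2 := by
        have h := integral_bump_pointPairInv n z
        rw [integral_complex_ofReal] at h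
        have h' : ∫ w : ℍ, bump n (pointPairInv z w) = 1 := by exact_mod_cast h
        rw [h', one_mul]
    _ < ε := by linarith

end ApproximateIdentity

/-! ## 7. Maass cusp form bases: local Weyl law and absolute convergence of the spectral side -/

section Convergence

variable {ι : Type*} {k : ℝ → ℝ}

/-- The decay (1.63) of an admissible transform supplies a decreasing majorant `H(t) = A (t+1)^{-2-ε}`
with `(t + 1) H(t)` integrable, as required by (12.5) and by the partial summation of
`ModularPretrace.lean`. [cite: Iwaniec2002, (1.63), PDF p. 24] -/
theorem exists_majorant_of_admissible (hka : IsAdmissibleTransform (selbergTransform k)) :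
    ∃ H : ℝ → ℝ, AntitoneOn H (Ici 0) ∧ (∀ t, 0 ≤ t → 0 ≤ H t) ∧
      IntegrableOn (fun t => (t + 1) * H t) (Ioi 0) ∧ ∀ r : ℝ, ‖selbergTransform k r‖ ≤ H |r| := by
  obtain ⟨ε, hε, _, A, hA⟩ := hka.holo_decay
  have hA0 : 0 ≤ A := by
    have h := hA 0 (by simp; linarith)
    have h1 : (0 : ℝ) < (‖(0 : ℂ)‖ + 1) ^ (-(2 + ε)) := Real.rpow_pos_of_pos (by simp) _
    by_contra hneg
    have : A * (‖(0 : ℂ)‖ + 1) ^ (-(2 + ε)) < 0 := mul_neg_of_neg_of_pos (not_le.mp hneg) h1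
    linarith [norm_nonneg (selbergTransform k 0)]
  refine ⟨fun t => A * (t + 1) ^ (-(2 + ε)), ?_, ?_, ?_, ?_⟩
  · intro a ha b _ hab
    have ha' : (0 : ℝ) ≤ a := ha
    apply mul_le_mul_of_nonneg_left _ hA0
    exact Real.rpow_le_rpow_of_nonpos (by linarith) (by linarith) (by linarith)
  · intro t ht
    positivity
  · have hi : IntegrableOn (fun t : ℝ => A * (t + 1) ^ (-(1 + ε))) (Ioi 0) :=
      (integrableOn_add_rpow_Ioi_of_lt (by linarith : -(1 + ε) < -1) (by norm_num : -(1 : ℝ) < 0)).const_mul A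
    refine hi.congr_fun (fun t ht => ?_) measurableSet_Ioi
    have ht0 : (0 : ℝ) < t := ht
    have ht1 : 0 < t + 1 := by linarith
    show A * (t + 1) ^ (-(1 + ε)) = (t + 1) * (A * (t + 1) ^ (-(2 + ε)))
    rw [show -(1 + ε) = 1 + (-(2 + ε)) by ring, Real.rpow_add ht1, Real.rpow_one]
    ring
  · intro r
    have h := hA r (by simp; linarith)
    simpa using h

local notation "P𝓒" => (cuspSubmodule.orthogonalProjectionOnto :
  Lp ℂ 2 (MeasureTheory.Measure.restrict (volume : Measure ℍ) ModularGroup.fd) →L[ℂ] cuspSubmodule)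

variable (b : HilbertBasis ι ℂ cuspSubmodule) (u : ι → ℍ → ℂ) (t : ι → ℝ)
  (hu : ∀ i, IsMaassCuspForm (u i) (t i))
  (hub : ∀ i, u i =ᵐ[μ𝒟] ((b i : cuspSubmodule) : Lp ℂ 2 μ𝒟))

include hub in
/-- The representing Maass forms are in `L²(𝒟)`. [folklore] -/
theorem memLp_maassBasis (i : ι) : MemLp (u i) 2 μ𝒟 :=
  (Lp.memLp _).ae_eq (hub i).symm

include hub in
/-- Orthonormality of the representing Maass forms in `L²(𝒟)`: `∫_𝒟 u_i ū_j = δ_{ij}`. [folklore] -/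
theorem setIntegral_maassBasis_mul_conj [DecidableEq ι] (i j : ι) :
    ∫ z in ModularGroup.fd, u i z * conj (u j z) = if i = j then 1 else 0 := by
  have h := orthonormal_iff_ite.mp b.orthonormal j i
  rw [Submodule.coe_inner, L2.inner_def] at h
  have e : (fun z => ⟪((b j : cuspSubmodule) : Lp ℂ 2 μ𝒟) z, ((b i : cuspSubmodule) : Lp ℂ 2 μ𝒟) z⟫_ℂ) =ᵐ[μ𝒟]
      fun z => u i z * conj (u j z) := by
    filter_upwards [hub i, hub j] with z hi hj
    rw [← hi, ← hj]
    simp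
  rw [integral_congr_ae e] at h
  rw [h]
  by_cases hij : i = j
  · subst hij; simp
  · rw [if_neg hij, if_neg (Ne.symm hij)]

include hu hub in
/-- **(7.10), discrete part, for a Hilbert basis of Maass cusp forms of `SL₂(ℤ)`**:
`Σ_{|t_i| < T, i ∈ S} |u_i(z)|² ≤ (2048/π) N(z) T²` for every finite `S` (`LocalWeylLaw.lean`).
[cite: Iwaniec2002, Prop. 7.2 (7.10), PDF p. 73] -/
theorem maassBasis_localBound (z : ℍ) {T : ℝ} (hT : 1 ≤ T) (S : Finset ι) (hS : ∀ i ∈ S, |t i| < T) :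
    ∑ i ∈ S, ‖u i z‖ ^ 2 ≤ (2048 / π) * orbitCount Γℤ (1 / 4096) z * T ^ 2 := by
  classical
  exact sum_norm_sq_eigenfunctions_le modular_le_range_toGL neg_one_mem_modular isDiscreteSubgroup_modular
    isHypFundamentalDomain_modular_fd S u t (fun i _ => (hu i).automorphic) (fun i _ => (hu i).isC2)
    (fun i _ => (hu i).eigen) (fun i _ => memLp_maassBasis b u hub i)
    (fun i _ j _ => setIntegral_maassBasis_mul_conj b u hub i j) hT hS z

include hu hub in
/-- **Absolute convergence of the spectral side of (7.17)** for an admissible transform: the cuspidal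
series `Σ_i h(t_i) u_i(z) ū_i(w)` is absolutely summable and the Eisenstein integrand
`h(r) E(z, 1/2+ir) Ē(w, 1/2+ir)` is integrable — by (7.10) at `z` and `w`, Cauchy's inequality and
partial summation (`ModularPretrace.lean`), the Eisenstein half of (7.10) coming from Parseval
(`eisenstein_localWeyl_of_parseval`). [cite: Iwaniec2002, Thm 7.4 & (12.5), PDF pp. 76, 125] -/
theorem summable_and_integrable_spectral (h73 : ∀ f : ℍ → ℂ, IsFdTest f → HasModularParseval f)
    (hka : IsAdmissibleTransform (selbergTransform k)) (z w : ℍ) :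
    Summable (fun i => ‖selbergTransform k (t i) * u i z * conj (u i w)‖) ∧
      Integrable (fun r : ℝ => selbergTransform k r * eisensteinCrit z r * conj (eisensteinCrit w r)) := by
  obtain ⟨H, hH, hH0, hHi, hhH⟩ := exists_majorant_of_admissible hka
  constructor
  · exact (Pretrace.tsum_spectral_le t (fun i => u i z) (fun i => u i w) (fun r => selbergTransform k r)
      (fun T hT S hS => maassBasis_localBound b u t hu hub z hT S hS)
      (fun T hT S hS => maassBasis_localBound b u t hu hub w hT S hS) hH hH0 hHi hhH).1
  · obtain ⟨Az, hAz⟩ := eisenstein_localWeyl_of_parseval h73 z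
    obtain ⟨Aw, hAw⟩ := eisenstein_localWeyl_of_parseval h73 w
    obtain ⟨ε', hε', hdiff, _⟩ := hka.holo_decay
    have hopen : IsOpen {t : ℂ | |t.im| < 1 / 2 + ε'} :=
      isOpen_lt (continuous_abs.comp Complex.continuous_im) continuous_const
    have hhc : Continuous fun r : ℝ => selbergTransform k r := by
      have hd : ∀ r : ℝ, DifferentiableAt ℂ (selbergTransform k) (r : ℂ) := fun r =>
        hdiff.differentiableAt (hopen.mem_nhds (by simp; linarith))
      exact continuous_iff_continuousAt.mpr fun r => (hd r).continuousAt.comp Complex.continuous_ofReal.continuousAt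
    exact (Pretrace.integral_spectral_le (eisensteinCrit z) (eisensteinCrit w) (continuous_eisensteinCrit z)
      (continuous_eisensteinCrit w) (fun r => selbergTransform k r) hhc hAz hAw hH hH0 hHi hhH).1

end Convergence

/-! ## 8. The spectral expansion of automorphic kernels (Theorem 7.4 for `SL₂(ℤ)`) -/

section Expansion

variable {ι : Type*} {k : ℝ → ℝ}

local notation "P𝓒" => (cuspSubmodule.orthogonalProjectionOnto :
  Lp ℂ 2 (MeasureTheory.Measure.restrict (volume : Measure ℍ) ModularGroup.fd) →L[ℂ] cuspSubmodule)

/-- `⟨x, [g]⟩ = ∫ ū g` when `u` represents the class `x`. [folklore] -/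
theorem inner_coe_toLp_eq {X : Type*} [MeasurableSpace X] {μ : Measure X} (x : Lp ℂ 2 μ) {g u : X → ℂ}
    (hg : MemLp g 2 μ) (hux : u =ᵐ[μ] x) :
    ⟪x, hg.toLp g⟫_ℂ = ∫ a, conj (u a) * g a ∂μ := by
  rw [L2.inner_def]
  refine integral_congr_ae ?_
  filter_upwards [hg.coeFn_toLp, hux] with a hga hua
  rw [hga, ← hua, mul_comm]
  simp

/-- `conj 2 = 2` in `ℂ`. [folklore] -/
theorem conj_ofNat_two : conj (2 : ℂ) = 2 := by
  rw [show (2 : ℂ) = ((2 : ℝ) : ℂ) by norm_num, Complex.conj_ofReal]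

/-- Automorphic kernels are automorphic in the first variable. [folklore] -/
theorem isAutomorphic_automorphicKernel (hk : IsTestKernel k) (w : ℍ) :
    IsAutomorphic Γℤ (fun v => (automorphicKernel Γℤ k v w : ℂ)) := by
  obtain ⟨_, _, ⟨M, _, hM⟩⟩ := hk
  intro γ hγ v
  simp only
  rw [automorphicKernel_smul_left modular_le_range_toGL isDiscreteSubgroup_modular hM hγ v w]

variable (b : HilbertBasis ι ℂ cuspSubmodule) (u : ι → ℍ → ℂ) (t : ι → ℝ)
  (hu : ∀ i, IsMaassCuspForm (u i) (t i))
  (hub : ∀ i, u i =ᵐ[μ𝒟] ((b i : cuspSubmodule) : Lp ℂ 2 μ𝒟))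

include hu hub in
/-- **The Parseval identity for a pair of automorphic kernels** (`F = K₁(·, z)`, `G = K₂(·, w)`,
continuous test kernels): `2 L_{k₁}(K₂(·, w))(z) = (3/π)·4h₁(i/2)h₂(i/2) + Σ_i 4h₁(t_i)h₂(t_i) u_i(z) ū_i(w)
 + (1/4π) ∫ 4h₁(r)h₂(r) E(z, 1/2+ir) Ē(w, 1/2+ir) dr` — i.e. (7.17) for the composed point-pair invariant
`k₁ ∗ k₂`, whose transform is `h₁h₂`. The left side is `∫_𝒟 K₁(z, v) K₂(v, w) dμ(v)` unfolded; the
coefficients are those of §4. [cite: Iwaniec2002, Thm 7.3 (7.15) & §7.4, PDF pp. 75–76] -/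
theorem parseval_kernels (h73 : ∀ f : ℍ → ℂ, IsFdTest f → HasModularParseval f) {k₁ k₂ : ℝ → ℝ} (hk₁ : IsTestKernel k₁)
    (hk₁c : Continuous k₁) (hk₂ : IsTestKernel k₂) (hk₂c : Continuous k₂) (z w : ℍ) :
    2 * invariantOperator k₁ (fun v => (automorphicKernel Γℤ k₂ v w : ℂ)) z =
      3 / π * (4 * selbergTransform k₁ (Complex.I / 2) * selbergTransform k₂ (Complex.I / 2)) +
      ∑' i, 4 * selbergTransform k₁ (t i) * selbergTransform k₂ (t i) * u i z * conj (u i w) +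
      1 / (4 * π) * ∫ r : ℝ, 4 * selbergTransform k₁ r * selbergTransform k₂ r *
        eisensteinCrit z r * conj (eisensteinCrit w r) := by
  have hΓ := modular_le_range_toGL
  have hneg := neg_one_mem_modular
  have hd := isDiscreteSubgroup_modular
  have hF𝒟 := isHypFundamentalDomain_modular_fd
  obtain ⟨_, _, ⟨M₁, _, hM₁⟩⟩ := id hk₁
  set F : ℍ → ℂ := fun v => (automorphicKernel Γℤ k₁ v z : ℂ) with hFdef
  set G : ℍ → ℂ := fun v => (automorphicKernel Γℤ k₂ v w : ℂ) with hGdef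
  have hF : IsFdTest F := isFdTest_automorphicKernel hk₁ hk₁c z
  have hG : IsFdTest G := isFdTest_automorphicKernel hk₂ hk₂c w
  have hP := parseval_polar h73 hF hG
  -- the left-hand side, unfolded
  have hGc : Continuous G := Complex.continuous_ofReal.comp (continuous_automorphicKernel_left hΓ hd hk₂ hk₂c w)
  have hL : (∫ v in ModularGroup.fd, conj (F v) * G v) = 2 * invariantOperator k₁ G z := by
    rw [← setIntegral_automorphicKernel_mul hΓ hneg hd hF𝒟 hk₁ (isAutomorphic_automorphicKernel hk₂ w)
      hGc.locallyIntegrable z]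
    refine setIntegral_congr_fun hF𝒟.measurableSet fun v _ => ?_
    simp only [hFdef]
    rw [Complex.conj_ofReal, automorphicKernel_comm hΓ hd hM₁ v z]
  -- the constant terms
  have hcF : conj (∫ v in ModularGroup.fd, F v) = 2 * selbergTransform k₁ (Complex.I / 2) := by
    rw [hFdef, setIntegral_fd_automorphicKernel hk₁ z, selbergTransform_I_half hk₁, map_mul, conj_ofNat_two,
      Complex.conj_ofReal]
  have hcG : (∫ v in ModularGroup.fd, G v) = 2 * selbergTransform k₂ (Complex.I / 2) := by
    rw [hGdef, setIntegral_fd_automorphicKernel hk₂ w, selbergTransform_I_half hk₂]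
  -- the cuspidal terms through the Hilbert basis of Maass cusp forms
  have hcusp : ⟪P𝓒 (hF.memLp_two.toLp F), P𝓒 (hG.memLp_two.toLp G)⟫_ℂ =
      ∑' i, 4 * selbergTransform k₁ (t i) * selbergTransform k₂ (t i) * u i z * conj (u i w) := by
    rw [← (b.hasSum_inner_mul_inner (P𝓒 (hF.memLp_two.toLp F)) (P𝓒 (hG.memLp_two.toLp G))).tsum_eq]
    refine tsum_congr fun i => ?_
    rw [Submodule.inner_orthogonalProjectionOnto_eq_of_mem_right,
      Submodule.inner_orthogonalProjectionOnto_eq_of_mem_left, ← inner_conj_symm,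
      inner_coe_toLp_eq _ hF.memLp_two (hub i), inner_coe_toLp_eq _ hG.memLp_two (hub i)]
    rw [hFdef, hGdef, setIntegral_fd_conj_mul_automorphicKernel hk₁ (hu i).automorphic (hu i).isC2 (t i)
      (hu i).eigen z, setIntegral_fd_conj_mul_automorphicKernel hk₂ (hu i).automorphic (hu i).isC2 (t i)
      (hu i).eigen w]
    rw [map_mul, map_mul, Complex.conj_conj, conj_selbergTransform_ofReal, conj_ofNat_two]
    ring
  -- the Eisenstein terms
  have heis : (fun r : ℝ => conj (eisenCoeff F r) * eisenCoeff G r) = fun r : ℝ =>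
      4 * selbergTransform k₁ r * selbergTransform k₂ r * eisensteinCrit z r * conj (eisensteinCrit w r) := by
    funext r
    rw [hFdef, hGdef, eisenCoeff_automorphicKernel hk₁ z r, eisenCoeff_automorphicKernel hk₂ w r,
      map_mul, map_mul, Complex.conj_conj, conj_selbergTransform_ofReal, conj_ofNat_two]
    ring
  rw [hL, hcF, hcG, hcusp, heis] at hP
  rw [hP]
  ring

include hu hub in
/-- **Theorem 7.4 (7.17) for `SL₂(ℤ)` from the Parseval identity.** For a continuous compactly
supported point-pair invariant `k` whose transform `h` satisfies (1.63), every Hilbert basis of Maass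
cusp forms `u_i` (spectral parameters `t_i ∈ ℝ`) of `𝓒`, and all `z, w ∈ ℍ`:
`Σ_{γ ∈ SL₂(ℤ)} k(u(γz, w)) = 2 [ (3/π) h(i/2) + Σ_i h(t_i) u_i(z) ū_i(w)
  + (1/4π) ∫ h(r) E(z, 1/2+ir) Ē(w, 1/2+ir) dr ]`, the series and the integral converging absolutely.
Proof: the pair identity `parseval_kernels` with `k₁ = k_n` an approximate identity (`h_n → 1`
boundedly, `L_{k_n} K(·, w)(z) → K(z, w)`) and dominated convergence on the spectral side, justified by
the local Weyl law. (The book argues through (7.15) for `f ∈ 𝓓(Γ\ℍ)` and "a suitable approximation".)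
[cite: Iwaniec2002, Thm 7.4 (7.17), PDF p. 76] -/
theorem automorphicKernel_eq_spectralExpansion (h73 : ∀ f : ℍ → ℂ, IsFdTest f → HasModularParseval f) (hk : IsTestKernel k)
    (hkc : Continuous k) (hka : IsAdmissibleTransform (selbergTransform k)) (z w : ℍ) :
    (automorphicKernel Γℤ k z w : ℂ) =
      2 * (((3 / π : ℝ) : ℂ) * selbergTransform k (Complex.I / 2) +
        ∑' i, selbergTransform k (t i) * u i z * conj (u i w) +
        ((1 / (4 * π) : ℝ) : ℂ) * ∫ r : ℝ, selbergTransform k r * eisensteinCrit z r * conj (eisensteinCrit w r)) := by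
  have hΓ := modular_le_range_toGL
  have hd := isDiscreteSubgroup_modular
  obtain ⟨hsum, hint⟩ := summable_and_integrable_spectral b u t hu hub h73 hka z w
  -- notation
  set h : ℂ → ℂ := selbergTransform k with hh
  set E : ℍ → ℝ → ℂ := eisensteinCrit with hE
  set G : ℍ → ℂ := fun v => (automorphicKernel Γℤ k v w : ℂ) with hGdef
  have hGc : Continuous G := Complex.continuous_ofReal.comp (continuous_automorphicKernel_left hΓ hd hk hkc w)
  -- the identities at level `n`
  have hn : ∀ n : ℕ, 2 * invariantOperator (bump n) G z =
      3 / π * (4 * selbergTransform (bump n) (Complex.I / 2) * h (Complex.I / 2)) +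
      ∑' i, 4 * selbergTransform (bump n) (t i) * h (t i) * u i z * conj (u i w) +
      1 / (4 * π) * ∫ r : ℝ, 4 * selbergTransform (bump n) r * h r * E z r * conj (E w r) :=
    fun n => parseval_kernels b u t hu hub h73 (isTestKernel_bump n) (continuous_bump n) hk hkc z w
  -- the limit of the left-hand side
  have hlhs : Tendsto (fun n : ℕ => 2 * invariantOperator (bump n) G z) atTop (𝓝 (2 * G z)) :=
    (tendsto_invariantOperator_bump hGc z).const_mul 2
  -- the limit of the cuspidal series (dominated convergence)
  have hdisc : Tendsto (fun n : ℕ => ∑' i, 4 * selbergTransform (bump n) (t i) * h (t i) * u i z * conj (u i w))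
      atTop (𝓝 (∑' i, 4 * h (t i) * u i z * conj (u i w))) := by
    refine tendsto_tsum_of_dominated_convergence (bound := fun i => 4 * ‖h (t i) * u i z * conj (u i w)‖)
      (hsum.mul_left 4) (fun i => ?_) (Eventually.of_forall fun n i => ?_)
    · have e : (fun n : ℕ => 4 * selbergTransform (bump n) (t i) * h (t i) * u i z * conj (u i w)) =
          fun n : ℕ => 4 * selbergTransform (bump n) (t i) * (h (t i) * u i z * conj (u i w)) := by
        funext n; ring
      rw [e, show 4 * h (t i) * u i z * conj (u i w) = 4 * 1 * (h (t i) * u i z * conj (u i w)) by ring]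
      exact ((tendsto_selbergTransform_bump (t i)).const_mul 4).mul_const _
    · rw [show 4 * selbergTransform (bump n) (t i) * h (t i) * u i z * conj (u i w) =
          (4 * selbergTransform (bump n) (t i)) * (h (t i) * u i z * conj (u i w)) by ring, norm_mul, norm_mul]
      have h4 : ‖(4 : ℂ)‖ = 4 := by simp
      rw [h4]
      have := norm_selbergTransform_bump_le n (t i)
      have h0 : 0 ≤ ‖h (t i) * u i z * conj (u i w)‖ := norm_nonneg _
      nlinarith
  -- the limit of the Eisenstein integral (dominated convergence)
  have heis : Tendsto (fun n : ℕ => ∫ r : ℝ, 4 * selbergTransform (bump n) r * h r * E z r * conj (E w r))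
      atTop (𝓝 (∫ r : ℝ, 4 * h r * E z r * conj (E w r))) := by
    refine tendsto_integral_of_dominated_convergence (fun r => 4 * ‖h r * E z r * conj (E w r)‖)
      (fun n => ?_) ((hint.norm).const_mul 4) (fun n => ?_) ?_
    · refine Continuous.aestronglyMeasurable ?_
      have hc1 : Continuous fun r : ℝ => selbergTransform (bump n) r :=
        (differentiable_selbergTransform (isTestKernel_bump n)).continuous.comp Complex.continuous_ofReal
      have hc2 : Continuous fun r : ℝ => h r :=
        (differentiable_selbergTransform hk).continuous.comp Complex.continuous_ofReal
      exact (((continuous_const.mul hc1).mul hc2).mul (continuous_eisensteinCrit z)).mul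
        (Complex.continuous_conj.comp (continuous_eisensteinCrit w))
    · refine Eventually.of_forall fun r => ?_
      rw [show 4 * selbergTransform (bump n) r * h r * E z r * conj (E w r) =
          (4 * selbergTransform (bump n) r) * (h r * E z r * conj (E w r)) by ring, norm_mul, norm_mul]
      have h4 : ‖(4 : ℂ)‖ = 4 := by simp
      rw [h4]
      have := norm_selbergTransform_bump_le n r
      have h0 : 0 ≤ ‖h r * E z r * conj (E w r)‖ := norm_nonneg _
      nlinarith
    · refine Eventually.of_forall fun r => ?_
      have e : (fun n : ℕ => 4 * selbergTransform (bump n) r * h r * E z r * conj (E w r)) =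
          fun n : ℕ => 4 * selbergTransform (bump n) r * (h r * E z r * conj (E w r)) := by
        funext n; ring
      rw [e, show 4 * h r * E z r * conj (E w r) = 4 * 1 * (h r * E z r * conj (E w r)) by ring]
      exact ((tendsto_selbergTransform_bump r).const_mul 4).mul_const _
  -- the constant term
  have hconst : Tendsto (fun n : ℕ => 3 / π * (4 * selbergTransform (bump n) (Complex.I / 2) * h (Complex.I / 2)))
      atTop (𝓝 (3 / π * (4 * h (Complex.I / 2)))) := by
    have : (fun n : ℕ => 3 / π * (4 * selbergTransform (bump n) (Complex.I / 2) * h (Complex.I / 2))) =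
        fun _ => 3 / π * (4 * h (Complex.I / 2)) := by
      funext n; rw [selbergTransform_bump_I_half]; ring
    rw [this]
    exact tendsto_const_nhds
  -- pass to the limit in the identities
  have hrhs := (hconst.add hdisc).add (heis.const_mul (1 / (4 * π) : ℂ))
  have heq : (fun n : ℕ => 2 * invariantOperator (bump n) G z) = fun n : ℕ =>
      3 / π * (4 * selbergTransform (bump n) (Complex.I / 2) * h (Complex.I / 2)) +
      ∑' i, 4 * selbergTransform (bump n) (t i) * h (t i) * u i z * conj (u i w) +
      1 / (4 * π) * ∫ r : ℝ, 4 * selbergTransform (bump n) r * h r * E z r * conj (E w r) := funext hn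
  rw [heq] at hlhs
  have hlim := tendsto_nhds_unique hlhs hrhs
  -- `G z = K(z, w)`
  have hGz : G z = (automorphicKernel Γℤ k z w : ℂ) := rfl
  rw [← hGz]
  have h2 : G z = (3 / π * (4 * h (Complex.I / 2)) + ∑' i, 4 * h (t i) * u i z * conj (u i w) +
      1 / (4 * π) * ∫ r : ℝ, 4 * h r * E z r * conj (E w r)) / 2 := by
    rw [← hlim]; ring
  rw [h2, show (fun i => 4 * h (t i) * u i z * conj (u i w)) = fun i => 4 * (h (t i) * u i z * conj (u i w)) by
    funext i; ring, tsum_mul_left, show (fun r : ℝ => 4 * h r * E z r * conj (E w r)) =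
    fun r : ℝ => 4 * (h r * E z r * conj (E w r)) by funext r; ring, integral_const_mul]
  push_cast
  ring

end Expansion

/-! ## 9. The spectral datum of `SL₂(ℤ)`: Theorem 7.4, (12.5) and Corollary 12.2 from Theorem 7.3 -/

section Datum

open Encodable

/-- **`Iwaniec2002_thm_7_4_modular` from the Parseval identity (Theorems 4.7 & 7.3).** The spectral datum of
`SL₂(ℤ)\ℍ` (`ModularSpectralDatum`: Maass cusp forms `u_j` with real `t_j`, the Eisenstein series
`E(z, 1/2 + ir)`, the local Weyl law (7.10) and the expansion (7.17)) is assembled from: the Hilbert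
basis of Maass cusp forms of `𝓒` (Theorem 4.7, `MaassCuspForms.lean`) with Roelcke's bound for the
reality of the `t_j` (Theorem 11.4 / Corollary 11.5, `RoelckeSelbergBound.lean`), enumerated through
`ℕ` with zero padding; `E = eisensteinCrit` (`ModularEisensteinCriticalLine.lean`); (7.10) from
`LocalWeylLaw.lean` (discrete half) and `eisenstein_localWeyl_of_parseval` (continuous half); and
(7.17) from `automorphicKernel_eq_spectralExpansion`. The only hypothesis is the Parseval identity
`∀ f, IsFdTest f → HasModularParseval f`. [cite: Iwaniec2002, Thm 7.4 (7.17) & Prop. 7.2 (7.10), PDF pp. 73, 76] -/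
theorem Iwaniec2002_thm_7_4_modular_of_parseval (h73 : ∀ f : ℍ → ℂ, IsFdTest f → HasModularParseval f) :
    Iwaniec2002_thm_7_4_modular := by
  obtain ⟨s, b, hs, hb, hmem⟩ := exists_hilbertBasis_maassCuspForms
  haveI : Encodable s := hs.toEncodable
  -- the Maass cusp forms representing the basis vectors, with real spectral parameters
  choose U T hUT hUx _ using fun x : s => hmem x.1 x.2
  have hbx : ∀ x : s, ((b x : cuspSubmodule) : Lp ℂ 2 μ𝒟) = ((x.1 : cuspSubmodule) : Lp ℂ 2 μ𝒟) := fun x => by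
    rw [show b x = x.1 from congrFun hb x]
  have hub : ∀ x : s, U x =ᵐ[μ𝒟] ((b x : cuspSubmodule) : Lp ℂ 2 μ𝒟) := fun x => by rw [hbx]; exact hUx x
  have hL2 : ∀ x : s, MemLp (U x) 2 μ𝒟 := fun x => (Lp.memLp _).ae_eq (hub x).symm
  have hsq : ∀ x : s, IntegrableOn (fun z => ‖U x z‖ ^ 2) ModularGroup.fd := fun x =>
    (memLp_two_iff_integrable_sq_norm (hL2 x).1).mp (hL2 x)
  have hne : ∀ x : s, ∃ z, U x z ≠ 0 := by
    intro x
    by_contra hall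
    push Not at hall
    have h0 : U x = 0 := funext hall
    have hbx0 : (b x : cuspSubmodule) = 0 := by
      have h1 : ((b x : cuspSubmodule) : Lp ℂ 2 μ𝒟) = 0 := by
        apply Lp.eq_zero_iff_ae_eq_zero.mpr
        have := (hub x).symm
        rw [h0] at this
        exact this
      exact_mod_cast h1
    exact b.orthonormal.ne_zero x hbx0
  have hreal : ∀ x : s, (T x).im = 0 := fun x => by
    obtain ⟨_, _, _, him⟩ := (hUT x).eigenvalue_ge (hsq x) (hne x)
    exact him
  set t : s → ℝ := fun x => (T x).re with ht
  have htT : ∀ x : s, ((t x : ℝ) : ℂ) = T x := fun x => by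
    apply Complex.ext <;> simp [ht, hreal x]
  have hu : ∀ x : s, IsMaassCuspForm (U x) (t x) := fun x => by rw [htT]; exact hUT x
  -- zero padding through an enumeration of `s`
  set uN : ℕ → ℍ → ℂ := fun j => match decode₂ s j with
    | some x => U x
    | none => 0 with huN
  set tN : ℕ → ℝ := fun j => match decode₂ s j with
    | some x => t x
    | none => 0 with htN
  have huN_enc : ∀ x : s, uN (encode x) = U x := fun x => by simp [huN, decode₂_encode]
  have htN_enc : ∀ x : s, tN (encode x) = t x := fun x => by simp [htN, decode₂_encode]
  have huN_none : ∀ j : ℕ, j ∉ Set.range (encode : s → ℕ) → uN j = 0 := by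
    intro j hj
    have : decode₂ s j = none := by
      by_contra hne'
      exact hj ((decode₂_ne_none_iff).mp hne')
    simp [huN, this]
  -- case analysis on the padding
  have hcases : ∀ j : ℕ, (∃ x : s, encode x = j) ∨ uN j = 0 := by
    intro j
    by_cases hj : j ∈ Set.range (encode : s → ℕ)
    · obtain ⟨x, hx⟩ := hj; exact Or.inl ⟨x, hx⟩
    · exact Or.inr (huN_none j hj)
  refine ⟨⟨tN, uN, eisensteinCrit, ?_, ?_, ?_, ?_, ?_, isAutomorphic_eisensteinCrit,
    fun r => (isC2_and_eigen_eisensteinCrit r).1, fun r z => (isC2_and_eigen_eisensteinCrit r).2 z,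
    continuous_eisensteinCrit, ?_, ?_⟩⟩
  · -- automorphic
    intro j
    rcases hcases j with ⟨x, rfl⟩ | h0
    · rw [huN_enc]; exact (hu x).automorphic
    · rw [h0]; exact isAutomorphic_const Γℤ 0
  · -- C²
    intro j
    rcases hcases j with ⟨x, rfl⟩ | h0
    · rw [huN_enc]; exact (hu x).isC2
    · rw [h0]; exact isC2_const 0
  · -- eigen
    intro j z
    rcases hcases j with ⟨x, rfl⟩ | h0
    · rw [huN_enc, htN_enc]
      have := (hu x).eigen z
      push_cast at this ⊢
      exact this
    · rw [h0]
      simp only [Pi.zero_apply, mul_zero, add_zero]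
      exact hypLaplacian_const 0 z
  · -- cusp forms
    intro j y hy
    rcases hcases j with ⟨x, rfl⟩ | h0
    · rw [huN_enc]
      have e : ∀ ξ : ℝ, (⟨⟨ξ, y⟩, hy⟩ : ℍ) = pt ξ y := fun ξ => by
        unfold pt; rw [ofComplex_apply_of_im_pos]
      simp_rw [e]
      rw [intervalIntegral_pt_eq_cuspMean (U x) hy]
      exact (hu x).cuspidal _
    · rw [h0]; simp
  · -- square integrable
    intro j
    rcases hcases j with ⟨x, rfl⟩ | h0
    · rw [huN_enc]; exact hsq x
    · rw [h0]; simp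
  · -- (7.10)
    intro z
    obtain ⟨AE, hAE⟩ := eisenstein_localWeyl_of_parseval h73 z
    refine ⟨max (2048 / π * orbitCount Γℤ (1 / 4096) z) AE, fun T' hT' => ⟨fun S hS => ?_, ?_⟩⟩
    · classical
      have hT0 : 0 ≤ T' ^ 2 := sq_nonneg _
      set S' : Finset s := S.preimage encode (encode_injective.injOn) with hS'
      have hsum : ∑ j ∈ S, ‖uN j z‖ ^ 2 = ∑ x ∈ S', ‖U x z‖ ^ 2 := by
        have h := Finset.sum_preimage (encode : s → ℕ) S encode_injective.injOn (fun j => ‖uN j z‖ ^ 2)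
          (fun j _ hj' => by simp [huN_none j hj'])
        rw [← h, hS']
        simp only [huN_enc]
      rw [hsum]
      have hS'' : ∀ x ∈ S', |t x| < T' := by
        intro x hx
        rw [hS', Finset.mem_preimage] at hx
        have := hS (encode x) hx
        rwa [htN_enc] at this
      calc ∑ x ∈ S', ‖U x z‖ ^ 2 ≤ 2048 / π * orbitCount Γℤ (1 / 4096) z * T' ^ 2 :=
            maassBasis_localBound b U t hu hub z hT' S' hS''
        _ ≤ max (2048 / π * orbitCount Γℤ (1 / 4096) z) AE * T' ^ 2 :=
            mul_le_mul_of_nonneg_right (le_max_left _ _) hT0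
    · calc ∫ r in (-T')..T', ‖eisensteinCrit z r‖ ^ 2 ≤ AE * T' ^ 2 := hAE T' hT'
        _ ≤ max (2048 / π * orbitCount Γℤ (1 / 4096) z) AE * T' ^ 2 :=
            mul_le_mul_of_nonneg_right (le_max_right _ _) (sq_nonneg _)
  · -- (7.17)
    intro k hkc hkT hka z w
    obtain ⟨hsum, hint⟩ := summable_and_integrable_spectral b U t hu hub h73 hka z w
    have hexp := automorphicKernel_eq_spectralExpansion b U t hu hub h73 hkT hkc hka z w
    -- transport the sums from `s` to `ℕ`
    set G : ℕ → ℂ := fun j => selbergTransform k (tN j) * uN j z * conj (uN j w) with hG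
    have hG0 : ∀ j ∉ Set.range (encode : s → ℕ), G j = 0 := fun j hj => by
      simp [hG, huN_none j hj]
    have hGenc : (fun x : s => G (encode x)) = fun x => selbergTransform k (t x) * U x z * conj (U x w) := by
      funext x; simp [hG, huN_enc, htN_enc]
    have hsupp : Function.support G ⊆ Set.range (encode : s → ℕ) := by
      intro j hj
      by_contra hj'
      exact hj (hG0 j hj')
    have htsum : ∑' j, G j = ∑' x : s, selbergTransform k (t x) * U x z * conj (U x w) := by
      rw [← encode_injective.tsum_eq hsupp]
      exact congrArg tsum hGenc
    have hsumN : Summable fun j => ‖G j‖ := by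
      have h0 : ∀ j ∉ Set.range (encode : s → ℕ), (fun j => ‖G j‖) j = 0 := fun j hj => by
        simp [hG0 j hj]
      refine (encode_injective.summable_iff h0).mp ?_
      have : ((fun j => ‖G j‖) ∘ (encode : s → ℕ)) = fun x => ‖selbergTransform k (t x) * U x z * conj (U x w)‖ := by
        funext x; simp [Function.comp, hG, huN_enc, htN_enc]
      rw [this]
      exact hsum
    refine ⟨hsumN, hint, ?_⟩
    rw [show (∑' j, selbergTransform k (tN j) * uN j z * conj (uN j w)) = ∑' j, G j from rfl, htsum]
    exact hexp

/-- **(12.5) for the modular group from Theorem 7.3** (through Theorem 7.4, `ModularPretrace.lean`).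
[cite: Iwaniec2002, (12.5), PDF pp. 125–126] -/
theorem Iwaniec2002_eq_12_5_modular_of_parseval (h73 : ∀ f : ℍ → ℂ, IsFdTest f → HasModularParseval f) :
    Iwaniec2002_eq_12_5_modular :=
  Iwaniec2002_eq_12_5_modular_of_thm_7_4 (Iwaniec2002_thm_7_4_modular_of_parseval h73)

/-- **Corollary 12.2 (`sl2BallCount_asymp`) from Theorem 7.3**: the number of integer points on
`ad - bc = 1` with `a² + b² + c² + d² ≤ N` is `6N + O(N^{2/3})`, conditionally only on the Parseval
identity of `L²(SL₂(ℤ)\ℍ)`. [cite: Iwaniec2002, Cor. 12.2 (12.12), PDF p. 126] -/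
theorem sl2BallCount_asymp_of_parseval (h73 : ∀ f : ℍ → ℂ, IsFdTest f → HasModularParseval f) : sl2BallCount_asymp :=
  sl2BallCount_asymp_of_thm_7_4 (Iwaniec2002_thm_7_4_modular_of_parseval h73)

/-- (12.12) as printed, from Theorem 7.3. [cite: Iwaniec2002, Cor. 12.2 (12.12), PDF p. 126] -/
theorem modularHyperbolicCount_asymp_of_parseval (h73 : ∀ f : ℍ → ℂ, IsFdTest f → HasModularParseval f) :
    modularHyperbolicCount_asymp :=
  modularHyperbolicCount_asymp_of_thm_7_4 (Iwaniec2002_thm_7_4_modular_of_parseval h73)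

end Datum

end Literature.NumberTheory.Automorphic

end
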